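import Literature.Computability.FineGrained.FineGrainedWave0
import HarnessLib

/-!
# Impagliazzo–Paturi's width-for-variables reduction (Lemma 2 of *On the complexity of k-SAT*):
the combinatorial core, proved

Family `fine-grained` (trunk T-CPLX-FINE). Impagliazzo–Paturi, *On the complexity of k-SAT*,
JCSS 62 (2001) 367–375, prove `s_k ≤ (1 - d/k) s_∞` (Theorem 3, the named fact
`Literature.Computability.FineGrained.satExponent_le_satExponentLimit`; assembled from named facts in
`KSatExponentGap.lean`) from their **Lemma 2** (p. 373): a k-CNF `F` with no satisfying
assignment of fewer than `δ n` ones is equisatisfiable with a disjunction of few `k'`-CNFs on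
fewer variables, computable fast. The printed proof (§"Unique k-SAT", pp. 371–372, and the
sketch on p. 374) has a combinatorial part — the construction of the formulas `Φ_f` by
*renaming the unforced variables* and its correctness — and an algorithmic part (a time-bounded
machine computing the list, through the sparsification lemma of Impagliazzo–Paturi–Zane). This
file formalises and PROVES the combinatorial part completely, for clause lists over `ℕ`-indexed
variables (`KCNF k` of `FineGrainedWave0.lean`), in a form that a machine can compute literally
(`IPRename.reduce`, `IPRename.reduceList`) and that the assembly of Theorem 3 consumes
(`IPRename.satisfiable_of_mem_reduceList`, `IPRename.numVars_le_of_mem_reduceList`,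
`IPRename.length_reduceList_le`, `IPRename.exists_satisfiable_mem_reduceList`, with
`IPRename.exists_minimalSat`, `IPRename.card_onesBelow_le`, `IPRename.card_heavyVars_mul_le`).
Nothing of `FineGrainedWave0.lean` / `KSatExponentGap.lean` is restated; the named fact
`impagliazzoPaturi_lemma2` there keeps its meaning and is NOT discharged here (its machine half
remains).

## The construction (source, pp. 371–372) and what is proved

Fix a partition `(A, B)` of the variables, a block length `l`, blocks `B_1, …, B_p` of `B`, and
a vector `f = (f_1, …, f_p)`. For `x ∈ B`, `G_x` ("`x` is forced") is the DNF over the clauses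
`C ∋ x` all whose other variables are in `A` of "all other literals of `C` are false", and `G'_x`
("forced to be true") its restriction to the clauses containing `x` positively
(`IPRename.forced`, `IPRename.forcedTo`; clauses containing both `x` and `x̄` force nothing and
are excluded). `Ψ_x := G'_x ∨ (¬ G_x ∧ y_{i,r})`, `r` the number of unforced variables before `x`
in its block `B_i` (`IPRename.psi`; the selector `ρ_j` of the source), `Θ_i :=` "exactly `f_i`
of the `G_x`, `x ∈ B_i`, hold" (`IPRename.theta`), and
`Φ_f := CNF(F[x ↦ Ψ_x, x ∈ B]) ∧ ⋀_i CNF(Θ_i)` over the variables `A ∪ Y_1 ∪ … ∪ Y_p`,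
`|Y_i| = |B_i| - f_i`, renumbered below `n - Σ f_i` (`IPRename.reduce`; each substituted clause
and each `Θ_i` reads at most `k' = k (m k cap + m + 1)` variables, `m = max l 1`, and is written
as its truth-table CNF, `IPRename.cnf`). Proved:

* **soundness** (`evalCNF_decode`, `satisfiable_of_satisfiable_reduce`): for EVERY choice of the
  parameters, a satisfying assignment of `Φ_f` decodes (`x ↦ Ψ_x`) to one of `F`;
* **completeness** (`valVar_encode`, `satisfiable_reduce_withProfile`): a satisfying assignment
  `α` of `F` encodes into one of `Φ_f` for `f` the true forcing profile of `α`
  (forced variables carry their forced value because `α` satisfies the forcing clause; unforced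
  ones are renamed), and then `Φ_f` has `n - #{forced variables of B}` variables;
* **many forced variables** (`exists_critClause`, `exists_goodMask`): a *minimal* satisfying
  assignment is critical in each of its ones (§1.1), and some partition of the family described
  below forces at least a `(k-1)^{k-1}/k^k ≥ 1/(ek)` fraction of its *light* ones;
* **the list** `reduceList k cap l t φ` of all `Φ_{(A,B), f}` over the family of partitions and
  the vectors `f ≤ (|B_i|)_i` with `Σ f_i ≥ t`: every member is sound and has `≤ n - t`
  variables, there are at most `2^b (m+1)^{n/m+1}` members (`(l+1)^{n/l}` vectors in the
  source, p. 372), and some member is satisfiable as soon as `F` has a minimal satisfying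
  assignment with `(k-1)^{k-1} · #light ones ≥ k^k · t` (`exists_satisfiable_mem_reduceList`).

## Design: derandomisation by colour classes (deviation from the printed proof, same result)

The source draws the partition from a `k`-wise independent sample space of size `n^{O(k)}`
(Lemma 1 and the paragraph after it) and assumes, after sparsification, that every variable
occurs in at most `c` clauses. Here (i) only the *light* variables (`occ ≤ cap`) may enter `B` —
heavy ones are few, `(cap+1) · #heavy ≤ k · #clauses` (`card_heavyVars_mul_le`), which is what
the clause bound `≤ C n` of the vendored sparsification fact `Literature.Computability.FineGrained.sparsification`
controls — and (ii) the light variables are coloured greedily, in the order of their first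
occurrence, so that light variables sharing a clause get distinct colours (`IPRename.col`, `col_ne_col`, at most `b = k cap + k + 1` colours,
`col_le`); the family of partitions is "`B` = the light variables whose colour lies in `S`",
`S ⊆ [b]` (a constant-size family, `2^b` masks). Averaging over `g : [b] → [k]` with
`S = g⁻¹(0)` (`exists_good`: the events "colour `c ↦ 0`" are independent across distinct
colours, which is all Lemma 1 uses) gives a partition forcing `≥ (k-1)^{k-1}/k^k · #(light
critical variables)` variables, the source's `1/k (1 - 1/k)^{k-1} ≥ 1/(ek)`. The output width
`k'`, the number of disjuncts and the variable count are as printed up to the constants, which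
Theorem 3 does not see.

Other choices: all lists of variables (`occList`, `aList`, `bList`, new indices of the
`A`-variables) follow the order of first occurrence in the clause list, as a machine scanning the
input meets them; blocks are `B[i m, (i+1) m)` for `i < |B|` (trailing blocks empty, harmless);
`f`-vectors are truncated to the block sizes (`fAt`), so `reduce` is total; the truth-table CNF
keeps duplicate variables (no `dedup`), clause width `= |V| ≤ k'`.

## References

* R. Impagliazzo, R. Paturi, *On the complexity of k-SAT*, JCSS 62 (2001) 367–375,
  doi:10.1006/jcss.2000.1727 (not held; author copy read): §1.1 (critical clauses, forcing),
  §"Unique k-SAT" pp. 371–372 (Lemma 1, `G_x`, `G'_x`, `Θ_i`, `Ψ`, `Φ_f`, the count of the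
  vectors `f`), Lemma 2 (p. 373), proof sketches p. 374.
* R. Impagliazzo, R. Paturi, F. Zane, *Which problems have strongly exponential complexity?*,
  JCSS 63 (2001), Corollary 1 (the clause bound `≤ C n` motivating the light/heavy split).
-/

namespace Literature.Computability.FineGrained

namespace IPRename

/-! ### Clause lists and their semantics -/

/-- Boolean value of a clause (a list of literals `(i, b)`) under `v`: some literal has `v i = b`.
[folklore] -/
def evalClause (c : List (ℕ × Bool)) (v : ℕ → Bool) : Bool :=
  c.any fun l => v l.1 == l.2

/-- Boolean value of a clause list (conjunction). [folklore] -/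
def evalCNF (F : List (List (ℕ × Bool))) (v : ℕ → Bool) : Bool :=
  F.all fun c => evalClause c v

/-- `KCNF.eval` is `evalCNF` of the clause list. [folklore] -/
theorem eval_eq_evalCNF {k : ℕ} (φ : KCNF k) (v : ℕ → Bool) :
    φ.eval v = evalCNF φ.clauses v := rfl

/-- `evalCNF = true` clause by clause. [folklore] -/
theorem evalCNF_eq_true {F : List (List (ℕ × Bool))} {v : ℕ → Bool} :
    evalCNF F v = true ↔ ∀ c ∈ F, evalClause c v = true := by
  simp [evalCNF, List.all_eq_true]

/-- `evalClause = true` iff some literal is satisfied. [folklore] -/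
theorem evalClause_eq_true {c : List (ℕ × Bool)} {v : ℕ → Bool} :
    evalClause c v = true ↔ ∃ l ∈ c, v l.1 = l.2 := by
  simp [evalClause, List.any_eq_true]

/-- The variable `x` occurs in the clause `c`. [folklore] -/
def occursIn (x : ℕ) (c : List (ℕ × Bool)) : Bool :=
  c.any fun l => l.1 == x

/-- `occursIn` unfolded. [folklore] -/
theorem occursIn_eq_true {x : ℕ} {c : List (ℕ × Bool)} :
    occursIn x c = true ↔ ∃ l ∈ c, l.1 = x := by
  simp [occursIn, List.any_eq_true]

/-- A clause depends only on the values of its variables. [folklore] -/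
theorem evalClause_congr (c : List (ℕ × Bool)) {v w : ℕ → Bool}
    (h : ∀ l ∈ c, v l.1 = w l.1) : evalClause c v = evalClause c w := by
  unfold evalClause
  induction c with
  | nil => rfl
  | cons a t ih =>
    simp only [List.any_cons]
    rw [h a (by simp), ih (fun l hl => h l (by simp [hl]))]

/-- A clause list depends only on the values of its occurring variables. [folklore] -/
theorem evalCNF_congr (F : List (List (ℕ × Bool))) {v w : ℕ → Bool}
    (h : ∀ c ∈ F, ∀ l ∈ c, v l.1 = w l.1) : evalCNF F v = evalCNF F w := by
  unfold evalCNF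
  induction F with
  | nil => rfl
  | cons c t ih =>
    simp only [List.all_cons]
    rw [evalClause_congr c (h c (by simp)), ih (fun c' hc' => h c' (by simp [hc']))]

/-- Satisfiability of a `KCNF` in terms of total assignments `ℕ → Bool`. [folklore] -/
theorem satisfiable_iff_exists {k : ℕ} (φ : KCNF k) :
    φ.Satisfiable ↔ ∃ v : ℕ → Bool, φ.eval v = true := by
  constructor
  · rintro ⟨v, hv⟩
    exact ⟨_, hv⟩
  · rintro ⟨v, hv⟩
    refine ⟨fun i => v i.1, ?_⟩
    rw [← hv, eval_eq_evalCNF, eval_eq_evalCNF]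
    exact evalCNF_congr _ fun c hc l hl => by simp [φ.fst_lt_numVars c hc l hl]

/-! ### Occurrences, light and heavy variables -/

/-- `occ F x`: the number of clauses of `F` in which the variable `x` occurs.
[cite: ImpagliazzoPaturiJCSS2001, §"Unique k-SAT" (p. 371: "each variable appearing in at most c clauses")] -/
def occ (F : List (List (ℕ × Bool))) (x : ℕ) : ℕ :=
  F.countP (occursIn x)

/-- The set of variables occurring in `F`. [folklore] -/
def occVars (F : List (List (ℕ × Bool))) : Finset ℕ :=
  (F.flatMap fun c => c.map Prod.fst).toFinset

/-- The occurring variables in the order of their first occurrence. [folklore] -/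
def occList (F : List (List (ℕ × Bool))) : List ℕ :=
  (F.flatMap fun c => c.map Prod.fst).eraseDups

/-- Membership in `occVars`. [folklore] -/
theorem mem_occVars {F : List (List (ℕ × Bool))} {x : ℕ} :
    x ∈ occVars F ↔ ∃ c ∈ F, occursIn x c = true := by
  simp [occVars, occursIn_eq_true]

/-- Membership in `occList`. [folklore] -/
theorem mem_occList {F : List (List (ℕ × Bool))} {x : ℕ} : x ∈ occList F ↔ x ∈ occVars F := by
  rw [occList, List.mem_eraseDups, occVars, List.mem_toFinset]

/-- `List.eraseDups` (first occurrences kept) has no duplicates. [folklore] -/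
theorem nodup_eraseDups {α : Type*} [DecidableEq α] :
    ∀ l : List α, l.eraseDups.Nodup := by
  intro l
  induction' hn : l.length using Nat.strong_induction_on with n ih generalizing l
  cases l with
  | nil => simp
  | cons a as =>
    rw [List.eraseDups_cons, List.nodup_cons]
    refine ⟨fun h => ?_, ih _ (by subst hn; simpa using Nat.lt_succ_of_le (List.length_filter_le _ _)) _ rfl⟩
    have := List.mem_eraseDups.1 h
    simp at this

/-- `occList` has no duplicates. [folklore] -/
theorem nodup_occList (F : List (List (ℕ × Bool))) : (occList F).Nodup :=
  nodup_eraseDups _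

/-- The length of `occList` is the number of occurring variables. [folklore] -/
theorem length_occList (F : List (List (ℕ × Bool))) : (occList F).length = (occVars F).card := by
  rw [← List.toFinset_card_of_nodup (nodup_occList F)]
  congr 1
  ext x
  rw [List.mem_toFinset, mem_occList]

/-- A variable with a positive occurrence count occurs. [folklore] -/
theorem occ_pos_iff {F : List (List (ℕ × Bool))} {x : ℕ} : 0 < occ F x ↔ x ∈ occVars F := by
  rw [occ, List.countP_pos_iff, mem_occVars]

/-- Summing occurrence counts over a set of variables counts incidences, at most `k` per clause
of width `≤ k`. [folklore] -/
theorem sum_occ_le (F : List (List (ℕ × Bool))) {k : ℕ} (hk : ∀ c ∈ F, c.length ≤ k)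
    (H : Finset ℕ) : ∑ x ∈ H, occ F x ≤ k * F.length := by
  induction F with
  | nil => simp [occ]
  | cons c t ih =>
    have hocc : ∀ x, occ (c :: t) x = occ t x + (if occursIn x c = true then 1 else 0) := by
      intro x; simp [occ, List.countP_cons]
    simp only [hocc, Finset.sum_add_distrib, List.length_cons]
    have h1 := ih (fun c' hc' => hk c' (by simp [hc']))
    have h2 : (∑ x ∈ H, if occursIn x c = true then 1 else 0) ≤ k := by
      rw [Finset.sum_boole]
      calc ((H.filter fun x => occursIn x c = true).card : ℕ)
          ≤ (c.map Prod.fst).toFinset.card := by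
            refine Finset.card_le_card fun x hx => ?_
            simp only [Finset.mem_filter, occursIn_eq_true] at hx
            obtain ⟨l, hl, rfl⟩ := hx.2
            simp only [List.mem_toFinset, List.mem_map]
            exact ⟨l, hl, rfl⟩
        _ ≤ (c.map Prod.fst).length := List.toFinset_card_le _
        _ ≤ k := by simpa using hk c (by simp)
    calc ∑ x ∈ H, occ t x + ∑ x ∈ H, (if occursIn x c = true then 1 else 0)
        ≤ k * t.length + k := Nat.add_le_add h1 h2
      _ = k * (t.length + 1) := by ring

/-- The heavy variables (occurring in more than `cap` clauses) of `F`. [folklore] -/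
def heavyVars (F : List (List (ℕ × Bool))) (cap : ℕ) : Finset ℕ :=
  (occVars F).filter fun x => cap < occ F x

/-- **Few heavy variables**: `(cap + 1) · #heavy ≤ k · #clauses` for a clause list of width `≤ k`.
[cite: ImpagliazzoPaturiJCSS2001, §"Unique k-SAT" (bounded occurrences after sparsification)] -/
theorem card_heavyVars_mul_le (F : List (List (ℕ × Bool))) {k : ℕ} (hk : ∀ c ∈ F, c.length ≤ k)
    (cap : ℕ) : (cap + 1) * (heavyVars F cap).card ≤ k * F.length := by
  calc (cap + 1) * (heavyVars F cap).card = ∑ _x ∈ heavyVars F cap, (cap + 1) := by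
        rw [Finset.sum_const, smul_eq_mul, Nat.mul_comm]
    _ ≤ ∑ x ∈ heavyVars F cap, occ F x :=
        Finset.sum_le_sum fun x hx => (Finset.mem_filter.1 hx).2
    _ ≤ k * F.length := sum_occ_le F hk _

/-! ### Co-occurrence and the greedy colouring of the light variables -/

/-- `x` and `z` occur together in some clause of `F`. [folklore] -/
def cooccur (F : List (List (ℕ × Bool))) (x z : ℕ) : Bool :=
  F.any fun c => occursIn x c && occursIn z c

/-- `cooccur` is symmetric. [folklore] -/
theorem cooccur_comm (F : List (List (ℕ × Bool))) (x z : ℕ) : cooccur F x z = cooccur F z x := by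
  simp [cooccur, Bool.and_comm]

/-- `cooccur` unfolded. [folklore] -/
theorem cooccur_eq_true {F : List (List (ℕ × Bool))} {x z : ℕ} :
    cooccur F x z = true ↔ ∃ c ∈ F, occursIn x c = true ∧ occursIn z c = true := by
  simp [cooccur, List.any_eq_true]

/-- The variables co-occurring with `x` number at most `k · occ F x`. [folklore] -/
theorem card_filter_cooccur_le (F : List (List (ℕ × Bool))) {k : ℕ} (hk : ∀ c ∈ F, c.length ≤ k)
    (x : ℕ) (s : Finset ℕ) : (s.filter fun z => cooccur F x z = true).card ≤ k * occ F x := by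
  classical
  set G := F.filter (occursIn x) with hG
  calc (s.filter fun z => cooccur F x z = true).card
      ≤ (G.flatMap fun c => c.map Prod.fst).toFinset.card := by
        refine Finset.card_le_card fun z hz => ?_
        simp only [Finset.mem_filter, cooccur_eq_true] at hz
        obtain ⟨c, hc, hxc, hzc⟩ := hz.2
        obtain ⟨l, hl, rfl⟩ := occursIn_eq_true.1 hzc
        simp only [List.mem_toFinset, List.mem_flatMap, List.mem_map, hG, List.mem_filter]
        exact ⟨c, ⟨hc, hxc⟩, l, hl, rfl⟩
    _ ≤ (G.flatMap fun c => c.map Prod.fst).length := List.toFinset_card_le _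
    _ ≤ k * G.length := by
        rw [List.length_flatMap]
        have h : ∀ m ∈ G.map (fun c => (c.map Prod.fst).length), m ≤ k := by
          intro m hm
          obtain ⟨c, hc, rfl⟩ := List.mem_map.1 hm
          simpa using hk c (List.mem_of_mem_filter hc)
        simpa [Nat.mul_comm] using List.sum_le_card_nsmul _ k h
    _ = k * occ F x := by rw [occ, List.countP_eq_length_filter]

/-- The least natural number not in the list `l`. [folklore] -/
def freshNat (l : List ℕ) : ℕ :=
  Nat.find (p := fun m => m ∉ l)
    ⟨l.sum + 1, fun h => Nat.lt_irrefl _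
      (Nat.lt_succ_of_le (List.single_le_sum (fun _ _ => Nat.zero_le _) _ h))⟩

/-- `freshNat l ∉ l`. [folklore] -/
theorem freshNat_not_mem (l : List ℕ) : freshNat l ∉ l :=
  Nat.find_spec (p := fun m => m ∉ l) _

/-- Every number below `freshNat l` is in `l`. [folklore] -/
theorem mem_of_lt_freshNat {l : List ℕ} {m : ℕ} (h : m < freshNat l) : m ∈ l := by
  have := Nat.find_min (p := fun m => m ∉ l) _ h
  simpa using this

/-- `freshNat l` is at most the number of distinct entries of `l`. [folklore] -/
theorem freshNat_le_card (l : List ℕ) : freshNat l ≤ l.toFinset.card := by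
  have : Finset.range (freshNat l) ⊆ l.toFinset := fun m hm =>
    List.mem_toFinset.2 (mem_of_lt_freshNat (Finset.mem_range.1 hm))
  simpa using Finset.card_le_card this

/-- The variables occurring (for the first time) before `x`. [folklore] -/
def pre (F : List (List (ℕ × Bool))) (x : ℕ) : List ℕ :=
  (occList F).take ((occList F).idxOf x)

/-- Members of `pre F x` come strictly earlier than `x` in `occList`. [folklore] -/
theorem idxOf_lt_of_mem_pre {F : List (List (ℕ × Bool))} {x z : ℕ} (hz : z ∈ pre F x) :
    (occList F).idxOf z < (occList F).idxOf x :=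
  (List.mem_take_iff_idxOf_lt (List.mem_of_mem_take hz)).1 hz

/-- **The greedy colouring.** `col F cap x` is the least colour not used by an earlier (in the
order of first occurrence) *light* variable (`occ ≤ cap`) co-occurring with `x`. Only its values
on light occurring variables matter. (Replaces the `k`-wise independent sample space of the
source by a constant-size family of partitions; see the file header.) [folklore] -/
def col (F : List (List (ℕ × Bool))) (cap : ℕ) (x : ℕ) : ℕ :=
  freshNat ((pre F x).attach.filterMap fun z =>
    if occ F z.1 ≤ cap ∧ cooccur F x z.1 = true then some (col F cap z.1) else none)
termination_by (occList F).idxOf x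
decreasing_by exact idxOf_lt_of_mem_pre z.2

/-- The colours forbidden for `x`, characterised. [folklore] -/
theorem col_spec (F : List (List (ℕ × Bool))) (cap x : ℕ) :
    ∃ L : List ℕ, col F cap x = freshNat L ∧
      ∀ m, m ∈ L ↔ ∃ z ∈ pre F x, occ F z ≤ cap ∧ cooccur F x z = true ∧ col F cap z = m := by
  refine ⟨_, by rw [col], fun m => ?_⟩
  simp only [List.mem_filterMap, List.mem_attach, true_and, Subtype.exists,
    Option.ite_none_right_eq_some, Option.some.injEq]
  constructor
  · rintro ⟨z, hz, h, rfl⟩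
    exact ⟨z, hz, h.1, h.2, rfl⟩
  · rintro ⟨z, hz, h1, h2, rfl⟩
    exact ⟨z, hz, ⟨h1, h2⟩, rfl⟩

/-- Of two distinct occurring variables, one comes first. [folklore] -/
theorem mem_pre_or_mem_pre {F : List (List (ℕ × Bool))} {x z : ℕ} (hxz : x ≠ z)
    (hx : x ∈ occVars F) (hz : z ∈ occVars F) : z ∈ pre F x ∨ x ∈ pre F z := by
  rw [← mem_occList] at hx hz
  have hne : (occList F).idxOf x ≠ (occList F).idxOf z := fun e => hxz ((List.idxOf_inj hx).1 e)
  rcases lt_or_gt_of_ne hne with h | h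
  · exact Or.inr ((List.mem_take_iff_idxOf_lt hx).2 h)
  · exact Or.inl ((List.mem_take_iff_idxOf_lt hz).2 h)

/-- Co-occurring variables occur. [folklore] -/
theorem mem_occVars_of_cooccur {F : List (List (ℕ × Bool))} {x z : ℕ} (h : cooccur F x z = true) :
    x ∈ occVars F ∧ z ∈ occVars F := by
  obtain ⟨c, hc, hx, hz⟩ := cooccur_eq_true.1 h
  exact ⟨mem_occVars.2 ⟨c, hc, hx⟩, mem_occVars.2 ⟨c, hc, hz⟩⟩

/-- **Properness**: two distinct light variables occurring together in a clause get distinct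
colours. [folklore] -/
theorem col_ne_col (F : List (List (ℕ × Bool))) (cap : ℕ) {x z : ℕ} (hxz : x ≠ z)
    (hx : occ F x ≤ cap) (hz : occ F z ≤ cap) (h : cooccur F x z = true) :
    col F cap x ≠ col F cap z := by
  obtain ⟨hxo, hzo⟩ := mem_occVars_of_cooccur h
  wlog hlt : z ∈ pre F x generalizing x z
  · exact fun e => this hxz.symm hz hx (by rwa [cooccur_comm]) hzo hxo
      ((mem_pre_or_mem_pre hxz hxo hzo).resolve_left hlt) e.symm
  obtain ⟨L, hL, hmem⟩ := col_spec F cap x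
  intro e
  have : col F cap x ∈ L := (hmem _).2 ⟨z, hlt, hz, h, e.symm⟩
  rw [hL] at this
  exact freshNat_not_mem L this

/-- **Few colours**: a variable occurring in at most `cap` clauses of a width-`≤ k` clause list
gets a colour `≤ k · cap`. [folklore] -/
theorem col_le (F : List (List (ℕ × Bool))) {k : ℕ} (hk : ∀ c ∈ F, c.length ≤ k) (cap : ℕ)
    {x : ℕ} (hx : occ F x ≤ cap) : col F cap x ≤ k * cap := by
  classical
  obtain ⟨L, hL, hmem⟩ := col_spec F cap x
  rw [hL]
  refine (freshNat_le_card L).trans ?_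
  have hsub : L.toFinset ⊆ ((pre F x).toFinset.filter fun z => cooccur F x z = true).image
      (col F cap) := by
    intro m hm
    obtain ⟨z, hz, -, h2, rfl⟩ := (hmem m).1 (List.mem_toFinset.1 hm)
    exact Finset.mem_image.2 ⟨z, Finset.mem_filter.2 ⟨List.mem_toFinset.2 hz, h2⟩, rfl⟩
  calc L.toFinset.card
      ≤ (((pre F x).toFinset.filter fun z => cooccur F x z = true).image (col F cap)).card :=
        Finset.card_le_card hsub
    _ ≤ ((pre F x).toFinset.filter fun z => cooccur F x z = true).card := Finset.card_image_le
    _ ≤ k * occ F x := card_filter_cooccur_le F hk x _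
    _ ≤ k * cap := Nat.mul_le_mul_left k hx


/-! ### Cutting a list into blocks of a fixed length -/

/-- Blocks `L[i m, (i+1) m)` for `i < N` exhaust `L` as soon as `N ≥ |L|` (trailing blocks are
empty). [folklore] -/
theorem flatten_map_take_drop {α : Type*} {m : ℕ} (hm : 0 < m) :
    ∀ (N : ℕ) (L : List α), L.length ≤ N →
      ((List.range N).map fun i => (L.drop (i * m)).take m).flatten = L := by
  intro N
  induction N with
  | zero => intro L hL; simp [List.length_eq_zero_iff.1 (Nat.le_zero.1 hL)]
  | succ N ih =>
    intro L hL
    rw [List.range_succ_eq_map, List.map_cons, List.flatten_cons, List.map_map]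
    rcases L.eq_nil_or_concat' with rfl | -
    · simp
    · have h2 : ((List.range N).map ((fun i => (L.drop (i * m)).take m) ∘ Nat.succ)).flatten =
          L.drop m := by
        have := ih (L.drop m) (by simp; omega)
        rw [← this]
        congr 1
        refine List.map_congr_left fun i _ => ?_
        simp only [Function.comp_apply, List.drop_drop, Nat.succ_mul]
        ring_nf
      rw [h2, Nat.zero_mul, List.drop_zero, List.take_append_drop]

/-! ### Parameters of the reduction, the partition `(A, B)`, blocks and new indices -/

/-- The parameters of one disjunct of the reduction: the occurrence cap defining the *light*
variables, the block length `l` (`0` is read as `1`), the set of colours forming the side `B`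
of the partition, and the guessed numbers `f_i` of forced variables per block.
[cite: ImpagliazzoPaturiJCSS2001, §"Unique k-SAT", pp. 371–372] -/
structure Params where
  /-- light variables are those occurring in at most `cap` clauses -/
  cap : ℕ
  /-- the block length `l` -/
  len : ℕ
  /-- the colours of the light variables put into `B` -/
  mask : ℕ → Bool
  /-- `f_i`, the number of forced variables claimed for block `B_i` -/
  fv : List ℕ

variable (P : Params) (F : List (List (ℕ × Bool)))

/-- `x ∈ B`: `x` occurs, is light, and its colour is selected by the mask. Heavy variables are
always in `A`. [cite: ImpagliazzoPaturiJCSS2001, Lemma 1 (the partition (A, B))] -/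
def inB (x : ℕ) : Bool :=
  decide (x ∈ occVars F) && decide (occ F x ≤ P.cap) && P.mask (col F P.cap x)

/-- The side `B`, in increasing order. [folklore] -/
def bList : List ℕ := (occList F).filter (inB P F)

/-- The occurring variables of the side `A`, in increasing order. [folklore] -/
def aList : List ℕ := (occList F).filter fun x => !inB P F x

/-- The block length `m = max l 1`. [folklore] -/
def bsz : ℕ := max P.len 1

/-- The number of block indices used (`|B|`; blocks beyond `⌈|B|/m⌉` are empty). [folklore] -/
def numBlocks : ℕ := (bList P F).length

/-- The `i`-th block `B_i = B[i m, (i+1) m)` (consecutive, of length `m`, the last nonempty one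
possibly shorter). [cite: ImpagliazzoPaturiJCSS2001, p. 372 ("we partition B arbitrarily into
sets B_i of size l")] -/
def block (i : ℕ) : List ℕ := ((bList P F).drop (i * bsz P)).take (bsz P)

/-- `f_i`, truncated to the block size. [folklore] -/
def fAt (i : ℕ) : ℕ := min (P.fv.getD i 0) (block P F i).length

/-- `|Y_i| = |B_i| - f_i`, the number of new variables renaming the unforced variables of
block `i`. [cite: ImpagliazzoPaturiJCSS2001, p. 372 (the sets Y_i)] -/
def ycount (i : ℕ) : ℕ := (block P F i).length - fAt P F i

/-- The first new index of the variables `Y_i`: after the `A`-variables and `Y_0, …, Y_{i-1}`.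
[folklore] -/
def yOff : ℕ → ℕ
  | 0 => (aList P F).length
  | i + 1 => yOff i + ycount P F i

/-- `Σ_i f_i`, the number of variables saved. [folklore] -/
def fSum : ℕ := ((List.range (numBlocks P F)).map (fAt P F)).sum

/-- New index of an `A`-variable: its rank in `aList`. [folklore] -/
def newIdxA (x : ℕ) : ℕ := (aList P F).idxOf x

/-- New index of the `r`-th variable of `Y_i`. [folklore] -/
def newIdxY (i r : ℕ) : ℕ := yOff P F i + r

/-- The index of the block containing `x ∈ B`. [folklore] -/
def blockOf (x : ℕ) : ℕ := (bList P F).idxOf x / bsz P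

/-- The position of `x ∈ B` inside its block. [folklore] -/
def posIn (x : ℕ) : ℕ := (bList P F).idxOf x % bsz P

/-- `m ≥ 1`. [folklore] -/
theorem bsz_pos : 0 < bsz P := by unfold bsz; omega

/-- Membership in `bList`. [folklore] -/
theorem mem_bList {x : ℕ} : x ∈ bList P F ↔ inB P F x = true := by
  simp only [bList, List.mem_filter, mem_occList, and_iff_right_iff_imp]
  intro h
  simp only [inB, Bool.and_eq_true, decide_eq_true_eq] at h
  exact h.1.1

/-- Members of `B` occur and are light. [folklore] -/
theorem occ_le_of_inB {x : ℕ} (h : inB P F x = true) : x ∈ occVars F ∧ occ F x ≤ P.cap := by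
  simp only [inB, Bool.and_eq_true, decide_eq_true_eq] at h
  exact h.1

/-- Membership in `aList`. [folklore] -/
theorem mem_aList {x : ℕ} : x ∈ aList P F ↔ x ∈ occVars F ∧ inB P F x = false := by
  simp [aList, mem_occList]

/-- `bList` has no duplicates. [folklore] -/
theorem nodup_bList : (bList P F).Nodup := (nodup_occList F).filter _

/-- `aList` has no duplicates. [folklore] -/
theorem nodup_aList : (aList P F).Nodup := (nodup_occList F).filter _

/-- `|aList| + |bList| = #occurring variables`. [folklore] -/
theorem length_aList_add_length_bList :
    (aList P F).length + (bList P F).length = (occVars F).card := by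
  rw [aList, bList, ← length_occList, Nat.add_comm]
  exact (List.length_eq_length_filter_add (inB P F)).symm

/-- The blocks concatenate to `bList`. [folklore] -/
theorem flatten_blocks :
    ((List.range (numBlocks P F)).map (block P F)).flatten = bList P F :=
  flatten_map_take_drop (bsz_pos P) _ _ le_rfl

/-- Summing block sizes gives `|bList|`. [folklore] -/
theorem sum_length_block :
    ((List.range (numBlocks P F)).map fun i => (block P F i).length).sum = (bList P F).length := by
  conv_rhs => rw [← flatten_blocks P F]
  rw [List.length_flatten, List.map_map]
  rfl

/-- A member of a block is in `B`. [folklore] -/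
theorem mem_bList_of_mem_block {i x : ℕ} (h : x ∈ block P F i) : x ∈ bList P F :=
  List.mem_of_mem_drop (List.mem_of_mem_take h)

/-- Blocks have length at most `m`. [folklore] -/
theorem length_block_le (i : ℕ) : (block P F i).length ≤ bsz P := by
  simp [block]

/-- Blocks with `i m ≥ |B|` are empty. [folklore] -/
theorem block_eq_nil {i : ℕ} (hi : (bList P F).length ≤ i * bsz P) : block P F i = [] := by
  simp [block, List.drop_eq_nil_iff.2 hi]

/-- Blocks with index `≥ |B|` are empty. [folklore] -/
theorem block_eq_nil_of_le {i : ℕ} (hi : numBlocks P F ≤ i) : block P F i = [] :=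
  block_eq_nil P F ((hi.trans (Nat.le_mul_of_pos_right i (bsz_pos P))))

/-- Every block is duplicate-free. [folklore] -/
theorem nodup_block (i : ℕ) : (block P F i).Nodup :=
  ((nodup_bList P F).sublist (List.drop_sublist _ _)).sublist (List.take_sublist _ _)

/-- The elements of block `i`: `(B_i)[r] = B[i m + r]`. [folklore] -/
theorem getElem_block {i r : ℕ} (hr : r < (block P F i).length) :
    ∃ h : i * bsz P + r < (bList P F).length, (block P F i)[r] = (bList P F)[i * bsz P + r] := by
  have hr' := hr
  simp only [block, List.length_take, List.length_drop, lt_min_iff] at hr'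
  refine ⟨by omega, ?_⟩
  simp [block, List.getElem_take, List.getElem_drop]

/-- `x ∈ B` lies in block `blockOf x` at position `posIn x`. [folklore] -/
theorem getElem_block_blockOf {x : ℕ} (hx : x ∈ bList P F) :
    ∃ h : posIn P F x < (block P F (blockOf P F x)).length,
      (block P F (blockOf P F x))[posIn P F x] = x := by
  have hj := List.idxOf_lt_length_of_mem hx
  have hm := bsz_pos P
  have hdm := Nat.div_add_mod ((bList P F).idxOf x) (bsz P)
  have hlt : posIn P F x < (block P F (blockOf P F x)).length := by
    simp only [block, posIn, blockOf, List.length_take, List.length_drop, lt_min_iff]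
    refine ⟨Nat.mod_lt _ hm, ?_⟩
    rw [Nat.mul_comm]; omega
  refine ⟨hlt, ?_⟩
  obtain ⟨h, e⟩ := getElem_block P F hlt
  rw [e]
  have : blockOf P F x * bsz P + posIn P F x = (bList P F).idxOf x := by
    simp only [blockOf, posIn]; rw [Nat.mul_comm]; exact hdm
  simp only [this, List.getElem_idxOf hj]

/-- `x ∈ B` is a member of its block. [folklore] -/
theorem mem_block_blockOf {x : ℕ} (hx : x ∈ bList P F) : x ∈ block P F (blockOf P F x) := by
  obtain ⟨h, e⟩ := getElem_block_blockOf P F hx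
  have hm := List.getElem_mem h
  rwa [e] at hm

/-- `blockOf x` is in range for `x ∈ B`. [folklore] -/
theorem blockOf_lt {x : ℕ} (hx : x ∈ bList P F) : blockOf P F x < numBlocks P F := by
  by_contra h
  have := block_eq_nil_of_le P F (not_lt.1 h)
  have hm := mem_block_blockOf P F hx
  rw [this] at hm; simp at hm

/-- A member of block `i` at position `r` has `blockOf = i` and `posIn = r`. [folklore] -/
theorem blockOf_posIn_of_getElem {i r : ℕ} (hr : r < (block P F i).length) :
    blockOf P F (block P F i)[r] = i ∧ posIn P F (block P F i)[r] = r := by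
  obtain ⟨h, e⟩ := getElem_block P F hr
  have hidx : (bList P F).idxOf (block P F i)[r] = i * bsz P + r := by
    rw [e]; exact (nodup_bList P F).idxOf_getElem _ _
  have hrm : r < bsz P := hr.trans_le (length_block_le P F i)
  have hm := bsz_pos P
  refine ⟨?_, ?_⟩
  · rw [blockOf, hidx, Nat.mul_comm, Nat.mul_add_div hm, Nat.div_eq_of_lt hrm, Nat.add_zero]
  · rw [posIn, hidx, Nat.mul_comm, Nat.mul_add_mod, Nat.mod_eq_of_lt hrm]

/-- Distinct blocks are disjoint: a member of block `i` has `blockOf = i`. [folklore] -/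
theorem blockOf_eq_of_mem {x i : ℕ} (hx : x ∈ block P F i) : blockOf P F x = i := by
  obtain ⟨r, hr, rfl⟩ := List.getElem_of_mem hx
  exact (blockOf_posIn_of_getElem P F hr).1

/-- The position of a block member is its index in the block. [folklore] -/
theorem posIn_eq_idxOf {x i : ℕ} (hx : x ∈ block P F i) : posIn P F x = (block P F i).idxOf x := by
  obtain ⟨r, hr, rfl⟩ := List.getElem_of_mem hx
  rw [(blockOf_posIn_of_getElem P F hr).2, (nodup_block P F i).idxOf_getElem]

/-- `f_i ≤ |B_i|`. [folklore] -/
theorem fAt_le (i : ℕ) : fAt P F i ≤ (block P F i).length := min_le_right _ _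

/-- `f_i + |Y_i| = |B_i|`. [folklore] -/
theorem fAt_add_ycount (i : ℕ) : fAt P F i + ycount P F i = (block P F i).length := by
  unfold ycount; have := fAt_le P F i; omega

/-- `yOff` is monotone. [folklore] -/
theorem yOff_mono {i j : ℕ} (h : i ≤ j) : yOff P F i ≤ yOff P F j := by
  induction h with
  | refl => exact le_rfl
  | step _ ih => exact ih.trans (Nat.le_add_right _ _)

/-- One step of `yOff`. [folklore] -/
theorem yOff_succ (i : ℕ) : yOff P F (i + 1) = yOff P F i + ycount P F i := rfl

/-- `yOff i = |aList| + Σ_{i' < i} |Y_{i'}|`. [folklore] -/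
theorem yOff_eq (i : ℕ) :
    yOff P F i = (aList P F).length + ((List.range i).map (ycount P F)).sum := by
  induction i with
  | zero => simp [yOff]
  | succ i ih => rw [yOff, ih, List.range_succ]; simp [Nat.add_assoc]

/-- `Σ f_i ≤ |bList|`. [folklore] -/
theorem fSum_le : fSum P F ≤ (bList P F).length := by
  rw [← sum_length_block, fSum]
  exact List.sum_le_sum (fun i _ => fAt_le P F i)

/-- The total number of new variables: `yOff p + Σ f_i = #occurring variables`. [folklore] -/
theorem yOff_numBlocks_add_fSum :
    yOff P F (numBlocks P F) + fSum P F = (occVars F).card := by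
  rw [yOff_eq, fSum, ← length_aList_add_length_bList, ← sum_length_block, Nat.add_assoc,
    ← List.sum_map_add]
  congr 2
  refine List.map_congr_left fun i _ => ?_
  rw [Nat.add_comm]; exact fAt_add_ycount P F i

/-- New indices of `Y`-variables are below `yOff p`. [folklore] -/
theorem newIdxY_lt {i r : ℕ} (hi : i < numBlocks P F) (hr : r < ycount P F i) :
    newIdxY P F i r < yOff P F (numBlocks P F) :=
  calc newIdxY P F i r < yOff P F i + ycount P F i := Nat.add_lt_add_left hr _
    _ = yOff P F (i + 1) := (yOff_succ P F i).symm
    _ ≤ yOff P F (numBlocks P F) := yOff_mono P F hi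

/-- New indices of `A`-variables are below `|aList| = yOff 0`. [folklore] -/
theorem newIdxA_lt {x : ℕ} (hx : x ∈ aList P F) : newIdxA P F x < (aList P F).length :=
  List.idxOf_lt_length_of_mem hx

/-- `newIdxA` is injective on `aList`. [folklore] -/
theorem newIdxA_inj {x z : ℕ} (hx : x ∈ aList P F) (h : newIdxA P F x = newIdxA P F z) :
    x = z :=
  (List.idxOf_inj hx).1 h

/-- `newIdxY` is injective on valid pairs `(i, r)`, `r < |Y_i|`. [folklore] -/
theorem newIdxY_inj {i r i' r' : ℕ} (hr : r < ycount P F i) (hr' : r' < ycount P F i')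
    (h : newIdxY P F i r = newIdxY P F i' r') : i = i' ∧ r = r' := by
  unfold newIdxY at h
  rcases lt_trichotomy i i' with hlt | rfl | hgt
  · exfalso
    have := yOff_mono P F (Nat.succ_le_of_lt hlt)
    rw [yOff_succ] at this
    omega
  · exact ⟨rfl, by omega⟩
  · exfalso
    have := yOff_mono P F (Nat.succ_le_of_lt hgt)
    rw [yOff_succ] at this
    omega

/-- `A`-indices and `Y`-indices are distinct. [folklore] -/
theorem newIdxA_ne_newIdxY {x i r : ℕ} (hx : x ∈ aList P F) : newIdxA P F x ≠ newIdxY P F i r := by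
  have h1 := newIdxA_lt P F hx
  have h2 : (aList P F).length ≤ newIdxY P F i r :=
    (yOff_mono P F (Nat.zero_le i)).trans (Nat.le_add_right _ _)
  omega


/-! ### Writing a Boolean function of a list of variables as clauses -/

/-- All Boolean tuples of length `m` (in binary counting order, least significant bit first).
[folklore] -/
def tuples : ℕ → List (List Bool)
  | 0 => [[]]
  | m + 1 => (tuples m).flatMap fun bs => [false :: bs, true :: bs]

/-- There are `2^m` tuples. [folklore] -/
theorem length_tuples (m : ℕ) : (tuples m).length = 2 ^ m := by
  induction m with
  | zero => rfl
  | succ m ih => simp [tuples, List.length_flatMap, ih, Nat.pow_succ, Nat.mul_comm]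

/-- The tuples of length `m` are exactly the lists of length `m`. [folklore] -/
theorem mem_tuples {m : ℕ} {bs : List Bool} : bs ∈ tuples m ↔ bs.length = m := by
  induction m generalizing bs with
  | zero => cases bs <;> simp [tuples]
  | succ m ih =>
    cases bs with
    | nil => simp [tuples]
    | cons b bs =>
      simp only [tuples, List.mem_flatMap, List.mem_cons, List.cons.injEq, List.not_mem_nil,
        or_false, List.length_cons, Nat.add_right_cancel_iff]
      constructor
      · rintro ⟨bs', h', h⟩
        rcases h with ⟨-, rfl⟩ | ⟨-, rfl⟩ <;> exact ih.1 h'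
      · intro h
        refine ⟨bs, ih.2 h, ?_⟩
        cases b <;> simp

/-- The assignment described by the tuple `bs` on the variable list `V` (first occurrence wins;
`false` elsewhere). [folklore] -/
def asg (V : List ℕ) (bs : List Bool) : ℕ → Bool := fun v => bs.getD (V.idxOf v) false

/-- The clause excluding exactly the assignments that agree with `bs` on `V`. [folklore] -/
def clauseOf (V : List ℕ) (bs : List Bool) : List (ℕ × Bool) :=
  List.zipWith (fun v b => (v, !b)) V bs

/-- `cnf g V`: the conjunctive normal form of a Boolean function `g` reading only the variables
`V`, one clause per falsifying tuple (the truth-table CNF). [folklore] -/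
def cnf (g : (ℕ → Bool) → Bool) (V : List ℕ) : List (List (ℕ × Bool)) :=
  (tuples V.length).filterMap fun bs => if g (asg V bs) then none else some (clauseOf V bs)

/-- `g` reads only the variables in `V`. [folklore] -/
def DependsOn (g : (ℕ → Bool) → Bool) (V : List ℕ) : Prop :=
  ∀ w w' : ℕ → Bool, (∀ v ∈ V, w v = w' v) → g w = g w'

/-- `DependsOn` is monotone in the variable list. [folklore] -/
theorem DependsOn.mono {g : (ℕ → Bool) → Bool} {V W : List ℕ} (h : DependsOn g V) (hVW : V ⊆ W) :
    DependsOn g W := fun w w' hw => h w w' fun v hv => hw v (hVW hv)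

/-- Membership in `cnf`. [folklore] -/
theorem mem_cnf {g : (ℕ → Bool) → Bool} {V : List ℕ} {c : List (ℕ × Bool)} :
    c ∈ cnf g V ↔ ∃ bs, bs.length = V.length ∧ g (asg V bs) = false ∧ c = clauseOf V bs := by
  simp only [cnf, List.mem_filterMap, mem_tuples, Option.ite_none_left_eq_some,
    Option.some.injEq, Bool.not_eq_true]
  constructor
  · rintro ⟨bs, h1, h2, h3⟩; exact ⟨bs, h1, h2, h3.symm⟩
  · rintro ⟨bs, h1, h2, h3⟩; exact ⟨bs, h1, h2, h3.symm⟩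

/-- `cnf g V` has at most `2^{|V|}` clauses. [folklore] -/
theorem length_cnf_le (g : (ℕ → Bool) → Bool) (V : List ℕ) : (cnf g V).length ≤ 2 ^ V.length :=
  (List.length_filterMap_le _ _).trans (length_tuples _).le

/-- Clauses of `cnf g V` have width at most `|V|`. [folklore] -/
theorem length_clauseOf_le (V : List ℕ) (bs : List Bool) : (clauseOf V bs).length ≤ V.length := by
  simp [clauseOf, List.length_zipWith]

/-- The variables of the clauses of `cnf g V` are in `V`. [folklore] -/
theorem fst_mem_of_mem_clauseOf {V : List ℕ} {bs : List Bool} {l : ℕ × Bool}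
    (h : l ∈ clauseOf V bs) : l.1 ∈ V := by
  simp only [clauseOf, List.mem_iff_getElem, List.getElem_zipWith, List.length_zipWith] at h ⊢
  obtain ⟨i, hi, rfl⟩ := h
  exact ⟨i, by omega, rfl⟩

/-- `asg V (V.map w)` agrees with `w` on `V`. [folklore] -/
theorem asg_map {V : List ℕ} {w : ℕ → Bool} {v : ℕ} (hv : v ∈ V) : asg V (V.map w) v = w v := by
  unfold asg
  rw [List.getD_eq_getElem _ _ (by simpa using List.idxOf_lt_length_of_mem hv)]
  simp [List.getElem_idxOf (List.idxOf_lt_length_of_mem hv)]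

/-- **Truth-table CNF is correct**: for `g` reading only `V`, the clauses `cnf g V` hold under
`w` iff `g w`. [folklore] -/
theorem evalCNF_cnf {g : (ℕ → Bool) → Bool} {V : List ℕ} (hg : DependsOn g V) (w : ℕ → Bool) :
    evalCNF (cnf g V) w = g w := by
  cases hw : g w
  · -- the clause of the tuple `V.map w` is violated
    rw [Bool.eq_false_iff]
    intro h
    rw [evalCNF_eq_true] at h
    have hmem : clauseOf V (V.map w) ∈ cnf g V := by
      refine mem_cnf.2 ⟨V.map w, by simp, ?_, rfl⟩
      rw [← hw]; exact hg _ _ fun v hv => asg_map hv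
    have := evalClause_eq_true.1 (h _ hmem)
    obtain ⟨l, hl, hwl⟩ := this
    simp only [clauseOf, List.mem_iff_getElem, List.getElem_zipWith, List.length_zipWith,
      List.length_map] at hl
    obtain ⟨i, hi, rfl⟩ := hl
    simp at hwl
  · rw [evalCNF_eq_true]
    intro c hc
    obtain ⟨bs, hlen, hfalse, rfl⟩ := mem_cnf.1 hc
    by_contra hcl
    rw [Bool.not_eq_true, Bool.eq_false_iff, Ne, evalClause_eq_true, not_exists] at hcl
    have hagree : ∀ v ∈ V, w v = asg V bs v := by
      intro v hv
      have hj := List.idxOf_lt_length_of_mem hv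
      have hlit : ((V[V.idxOf v]'hj), !bs[V.idxOf v]'(hlen ▸ hj)) ∈ clauseOf V bs := by
        simp only [clauseOf, List.mem_iff_getElem, List.getElem_zipWith, List.length_zipWith]
        exact ⟨V.idxOf v, by omega, rfl⟩
      have hne := fun h => hcl _ ⟨hlit, h⟩
      simp only [List.getElem_idxOf hj] at hne
      unfold asg
      rw [List.getD_eq_getElem _ _ (hlen ▸ hj)]
      cases hb : bs[List.idxOf v V] <;> cases hw' : w v <;> simp_all
    have := hg _ _ hagree
    rw [hw, hfalse] at this
    exact Bool.noConfusion this


/-! ### Forcing with respect to the `A`-part of an assignment -/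

section Forcing

variable (P : Params) (F : List (List (ℕ × Bool)))

/-- The values of the `A`-variables (old indices) read off an assignment `w` of the new
variables. [folklore] -/
def aOf (w : ℕ → Bool) : ℕ → Bool := fun z => w (newIdxA P F z)

/-- The clauses of `F` that can force `x` to the value `p`: `x` occurs, every `x`-literal has
polarity `p`, every other variable is in `A` (the "(x, A)-clauses" / "positive (x, A)-clauses"
of the source; clauses containing both `x` and `x̄` force nothing and are excluded).
[cite: ImpagliazzoPaturiJCSS2001, p. 371] -/
def forcingClauses (x : ℕ) (p : Bool) : List (List (ℕ × Bool)) :=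
  F.filter fun c => occursIn x c &&
    c.all fun l => (l.1 == x && l.2 == p) || (l.1 != x && !inB P F l.1)

/-- All literals of `c` on variables other than `x` are false under `a`. [folklore] -/
def othersFalse (c : List (ℕ × Bool)) (x : ℕ) (a : ℕ → Bool) : Bool :=
  c.all fun l => l.1 == x || a l.1 != l.2

/-- `x` is forced to the value `p` by the `A`-assignment `a`: some clause that can force `x`
to `p` has all its other literals false (the DNFs `G'_x`, `p = true`, and its negative twin).
[cite: ImpagliazzoPaturiJCSS2001, p. 371 (G_x, G'_x)] -/
def forcedTo (x : ℕ) (p : Bool) (a : ℕ → Bool) : Bool :=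
  (forcingClauses P F x p).any fun c => othersFalse c x a

/-- `x` is forced by `a` (the DNF `G_x`). [cite: ImpagliazzoPaturiJCSS2001, p. 371 (G_x)] -/
def forced (x : ℕ) (a : ℕ → Bool) : Bool :=
  forcedTo P F x true a || forcedTo P F x false a

/-- The number of unforced variables of the block of `x` preceding `x`: the rank of an unforced
`x` among the renamed variables of its block (the selector `ρ_j` of the source).
[cite: ImpagliazzoPaturiJCSS2001, p. 372 (ρ_j)] -/
def unforcedBefore (x : ℕ) (a : ℕ → Bool) : ℕ :=
  ((block P F (blockOf P F x)).take (posIn P F x)).countP fun z => !forced P F z a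

/-- The value of the new variable renaming `x` (if `x` is unforced): `y_{i, r}` with `r` the
unforced rank of `x` in its block `i` (`false` if out of range). [cite: ImpagliazzoPaturiJCSS2001,
p. 372 (ρ_j)] -/
def yval (x : ℕ) (w : ℕ → Bool) : Bool :=
  if unforcedBefore P F x (aOf P F w) < ycount P F (blockOf P F x) then
    w (newIdxY P F (blockOf P F x) (unforcedBefore P F x (aOf P F w)))
  else false

/-- `Ψ_x = G'_x ∨ (¬ G_x ∧ ρ)`: "either `x` is forced to be true, or `x` is not forced and its
renaming variable is true". [cite: ImpagliazzoPaturiJCSS2001, p. 372 (Ψ_{i,x_j})] -/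
def psi (x : ℕ) (w : ℕ → Bool) : Bool :=
  forcedTo P F x true (aOf P F w) || (!forced P F x (aOf P F w) && yval P F x w)

/-- The decoded value of an old variable under a new assignment: `Ψ_x` for `x ∈ B`, the renamed
copy for `x ∈ A`. [folklore] -/
def valVar (x : ℕ) (w : ℕ → Bool) : Bool :=
  if inB P F x then psi P F x w else w (newIdxA P F x)

/-- A clause of `F` after the substitution `x ↦ Ψ_x` (`x ∈ B`), as a Boolean function of the
new variables. [cite: ImpagliazzoPaturiJCSS2001, p. 372 ("Substitute Ψ_{i,x_j} for x_j in F")] -/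
def gClause (c : List (ℕ × Bool)) (w : ℕ → Bool) : Bool :=
  c.any fun l => valVar P F l.1 w == l.2

/-- `Θ_i`: exactly `f_i` variables of block `i` are forced (the `f_i`-th slice function of the
`G_x`, `x ∈ B_i`). [cite: ImpagliazzoPaturiJCSS2001, p. 372 (Θ_i)] -/
def theta (i : ℕ) (w : ℕ → Bool) : Bool :=
  ((block P F i).countP fun z => forced P F z (aOf P F w)) == fAt P F i

/-! ### The variables read by these functions -/

/-- New indices of the `A`-variables sharing a clause with `x` (a superset of the variables read
by `G_x`). [folklore] -/
def depForced (x : ℕ) : List ℕ :=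
  (F.filter (occursIn x)).flatMap fun c =>
    (c.filter fun l => l.1 != x && !inB P F l.1).map fun l => newIdxA P F l.1

/-- The variables read by `Θ_i`. [folklore] -/
def depTheta (i : ℕ) : List ℕ := (block P F i).flatMap (depForced P F)

/-- The variables read by `Ψ_x` for `x` in block `i`: those of `Θ_i` and `Y_i`. [folklore] -/
def depBlock (i : ℕ) : List ℕ :=
  depTheta P F i ++ (List.range (ycount P F i)).map (newIdxY P F i)

/-- The variables read by the decoded value of `x`. [folklore] -/
def depVar (x : ℕ) : List ℕ :=
  if inB P F x then depBlock P F (blockOf P F x) else [newIdxA P F x]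

/-- The variables read by a substituted clause. [folklore] -/
def depClause (c : List (ℕ × Bool)) : List ℕ := c.flatMap fun l => depVar P F l.1

/-- `List.any` is extensional on the members of the list. [folklore] -/
theorem any_congr_mem {α : Type*} (l : List α) {p q : α → Bool} (h : ∀ a ∈ l, p a = q a) :
    l.any p = l.any q := by
  induction l with
  | nil => rfl
  | cons a t ih =>
    simp only [List.any_cons]
    rw [h a (by simp), ih fun b hb => h b (by simp [hb])]

/-- `List.all` is extensional on the members of the list. [folklore] -/
theorem all_congr_mem {α : Type*} (l : List α) {p q : α → Bool} (h : ∀ a ∈ l, p a = q a) :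
    l.all p = l.all q := by
  induction l with
  | nil => rfl
  | cons a t ih =>
    simp only [List.all_cons]
    rw [h a (by simp), ih fun b hb => h b (by simp [hb])]

/-- `List.countP` is extensional on the members of the list. [folklore] -/
theorem countP_congr_mem {α : Type*} (l : List α) {p q : α → Bool} (h : ∀ a ∈ l, p a = q a) :
    l.countP p = l.countP q :=
  List.countP_congr fun a ha => by rw [h a ha]

/-- Membership in `forcingClauses`. [folklore] -/
theorem mem_forcingClauses {x : ℕ} {p : Bool} {c : List (ℕ × Bool)} :
    c ∈ forcingClauses P F x p ↔ c ∈ F ∧ occursIn x c = true ∧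
      ∀ l ∈ c, (l.1 = x ∧ l.2 = p) ∨ (l.1 ≠ x ∧ inB P F l.1 = false) := by
  simp [forcingClauses, List.all_eq_true]

/-- `forcedTo x p` reads `a` only on `A`-variables sharing a clause with `x`. [folklore] -/
theorem forcedTo_congr (x : ℕ) (p : Bool) {a a' : ℕ → Bool}
    (h : ∀ c ∈ F, occursIn x c = true → ∀ l ∈ c, l.1 ≠ x → inB P F l.1 = false →
      a l.1 = a' l.1) :
    forcedTo P F x p a = forcedTo P F x p a' := by
  unfold forcedTo
  refine any_congr_mem _ fun c hc => ?_
  obtain ⟨hcF, hx, hl⟩ := (mem_forcingClauses P F).1 hc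
  unfold othersFalse
  refine all_congr_mem _ fun l hlc => ?_
  by_cases hlx : l.1 = x
  · simp [hlx]
  · rcases hl l hlc with ⟨h1, -⟩ | ⟨-, h2⟩
    · exact absurd h1 hlx
    · rw [h c hcF hx l hlc hlx h2]

/-- `forced x` reads `a` only on `A`-variables sharing a clause with `x`. [folklore] -/
theorem forced_congr (x : ℕ) {a a' : ℕ → Bool}
    (h : ∀ c ∈ F, occursIn x c = true → ∀ l ∈ c, l.1 ≠ x → inB P F l.1 = false →
      a l.1 = a' l.1) :
    forced P F x a = forced P F x a' := by
  unfold forced; rw [forcedTo_congr P F x true h, forcedTo_congr P F x false h]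

/-- Membership in `depForced`. [folklore] -/
theorem mem_depForced {x v : ℕ} :
    v ∈ depForced P F x ↔ ∃ c ∈ F, occursIn x c = true ∧ ∃ l ∈ c, l.1 ≠ x ∧
      inB P F l.1 = false ∧ newIdxA P F l.1 = v := by
  simp only [depForced, List.mem_flatMap, List.mem_filter, List.mem_map, Bool.and_eq_true,
    bne_iff_ne, ne_eq, Bool.not_eq_true']
  constructor
  · rintro ⟨c, ⟨hc, hx⟩, l, ⟨hl, h1, h2⟩, h3⟩; exact ⟨c, hc, hx, l, hl, h1, h2, h3⟩
  · rintro ⟨c, hc, hx, l, hl, h1, h2, h3⟩; exact ⟨c, ⟨hc, hx⟩, l, ⟨hl, h1, h2⟩, h3⟩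

/-- Agreement on `depForced x` makes the `A`-parts agree where `G_x` reads them. [folklore] -/
theorem aOf_agree {x : ℕ} {w w' : ℕ → Bool} (h : ∀ v ∈ depForced P F x, w v = w' v) :
    ∀ c ∈ F, occursIn x c = true → ∀ l ∈ c, l.1 ≠ x → inB P F l.1 = false →
      aOf P F w l.1 = aOf P F w' l.1 :=
  fun c hc hx l hl h1 h2 => h _ ((mem_depForced P F).2 ⟨c, hc, hx, l, hl, h1, h2, rfl⟩)

/-- `G_x` as a function of the new variables reads only `depForced x`. [folklore] -/
theorem forced_aOf_congr {x : ℕ} {w w' : ℕ → Bool} (h : ∀ v ∈ depForced P F x, w v = w' v) :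
    forced P F x (aOf P F w) = forced P F x (aOf P F w') :=
  forced_congr P F x (aOf_agree P F h)

/-- `depForced z ⊆ depTheta i` for `z ∈ B_i`. [folklore] -/
theorem depForced_subset_depTheta {i z : ℕ} (hz : z ∈ block P F i) :
    depForced P F z ⊆ depTheta P F i := fun _ hv =>
  List.mem_flatMap.2 ⟨z, hz, hv⟩

/-- `depTheta i ⊆ depBlock i`. [folklore] -/
theorem depTheta_subset_depBlock (i : ℕ) : depTheta P F i ⊆ depBlock P F i :=
  List.subset_append_left _ _

/-- `Θ_i` reads only `depTheta i`. [folklore] -/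
theorem theta_dependsOn (i : ℕ) : DependsOn (theta P F i) (depTheta P F i) := by
  intro w w' h
  unfold theta
  rw [countP_congr_mem _ fun z hz =>
    forced_aOf_congr P F fun v hv => h v (depForced_subset_depTheta P F hz hv)]

/-- The unforced rank reads only `depTheta (blockOf x)`. [folklore] -/
theorem unforcedBefore_congr (x : ℕ) {w w' : ℕ → Bool}
    (h : ∀ v ∈ depTheta P F (blockOf P F x), w v = w' v) :
    unforcedBefore P F x (aOf P F w) = unforcedBefore P F x (aOf P F w') := by
  unfold unforcedBefore
  refine countP_congr_mem _ fun z hz => ?_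
  rw [forced_aOf_congr P F fun v hv =>
    h v (depForced_subset_depTheta P F (List.mem_of_mem_take hz) hv)]

/-- `Ψ_x` reads only `depBlock (blockOf x)` (`x ∈ B`). [folklore] -/
theorem psi_dependsOn {x : ℕ} (hx : x ∈ bList P F) :
    DependsOn (psi P F x) (depBlock P F (blockOf P F x)) := by
  intro w w' h
  have hxb := mem_block_blockOf P F hx
  have hF : ∀ v ∈ depForced P F x, w v = w' v := fun v hv =>
    h v (depTheta_subset_depBlock P F _ (depForced_subset_depTheta P F hxb hv))
  have hT : ∀ v ∈ depTheta P F (blockOf P F x), w v = w' v := fun v hv =>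
    h v (depTheta_subset_depBlock P F _ hv)
  unfold psi yval
  rw [forcedTo_congr P F x true (aOf_agree P F hF), forced_aOf_congr P F hF,
    unforcedBefore_congr P F x hT]
  by_cases hr : unforcedBefore P F x (aOf P F w') < ycount P F (blockOf P F x)
  · rw [if_pos hr, if_pos hr, h]
    exact List.mem_append_right _ (List.mem_map.2 ⟨_, List.mem_range.2 hr, rfl⟩)
  · rw [if_neg hr, if_neg hr]

/-- The decoded value of an occurring variable reads only `depVar x`. [folklore] -/
theorem valVar_dependsOn (x : ℕ) : DependsOn (valVar P F x) (depVar P F x) := by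
  intro w w' h
  unfold valVar
  unfold depVar at h
  by_cases hB : inB P F x = true
  · rw [if_pos hB, if_pos hB]
    rw [if_pos hB] at h
    exact psi_dependsOn P F ((mem_bList P F).2 hB) w w' h
  · rw [if_neg hB, if_neg hB]
    rw [if_neg hB] at h
    exact h _ (by simp)

/-- `depVar l.1 ⊆ depClause c` for `l ∈ c`. [folklore] -/
theorem depVar_subset_depClause {c : List (ℕ × Bool)} {l : ℕ × Bool} (hl : l ∈ c) :
    depVar P F l.1 ⊆ depClause P F c := fun _ hv =>
  List.mem_flatMap.2 ⟨l, hl, hv⟩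

/-- A substituted clause reads only `depClause c`. [folklore] -/
theorem gClause_dependsOn (c : List (ℕ × Bool)) : DependsOn (gClause P F c) (depClause P F c) := by
  intro w w' h
  unfold gClause
  refine any_congr_mem _ fun l hl => ?_
  rw [valVar_dependsOn P F l.1 w w' fun v hv => h v (depVar_subset_depClause P F hl hv)]

/-! ### Sizes of the dependency lists -/

/-- `|depForced x| ≤ k · occ F x` for clause width `≤ k`. [folklore] -/
theorem length_depForced_le {k : ℕ} (hk : ∀ c ∈ F, c.length ≤ k) (x : ℕ) :
    (depForced P F x).length ≤ k * occ F x := by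
  unfold depForced
  rw [List.length_flatMap, occ, List.countP_eq_length_filter]
  have h : ∀ m ∈ (F.filter (occursIn x)).map
      (fun c => ((c.filter fun l => l.1 != x && !inB P F l.1).map fun l => newIdxA P F l.1).length),
      m ≤ k := by
    intro m hm
    obtain ⟨c, hc, rfl⟩ := List.mem_map.1 hm
    simpa using (List.length_filter_le _ _).trans (hk c (List.mem_of_mem_filter hc))
  simpa [Nat.mul_comm] using List.sum_le_card_nsmul _ k h

/-- `|depTheta i| ≤ m · k · cap` (members of blocks are light). [folklore] -/
theorem length_depTheta_le {k : ℕ} (hk : ∀ c ∈ F, c.length ≤ k) (i : ℕ) :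
    (depTheta P F i).length ≤ bsz P * (k * P.cap) := by
  unfold depTheta
  rw [List.length_flatMap]
  have h : ∀ m ∈ (block P F i).map (fun z => (depForced P F z).length), m ≤ k * P.cap := by
    intro m hm
    obtain ⟨z, hz, rfl⟩ := List.mem_map.1 hm
    have hzB := (mem_bList P F).1 (mem_bList_of_mem_block P F hz)
    exact (length_depForced_le P F hk z).trans
      (Nat.mul_le_mul_left k (occ_le_of_inB P F hzB).2)
  calc ((block P F i).map fun z => (depForced P F z).length).sum
      ≤ ((block P F i).map fun z => (depForced P F z).length).length * (k * P.cap) := by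
        simpa using List.sum_le_card_nsmul _ _ h
    _ ≤ bsz P * (k * P.cap) := by
        simpa using Nat.mul_le_mul_right _ (length_block_le P F i)

/-- `|depBlock i| ≤ m · k · cap + m`. [folklore] -/
theorem length_depBlock_le {k : ℕ} (hk : ∀ c ∈ F, c.length ≤ k) (i : ℕ) :
    (depBlock P F i).length ≤ bsz P * (k * P.cap) + bsz P := by
  unfold depBlock
  rw [List.length_append, List.length_map, List.length_range]
  refine Nat.add_le_add (length_depTheta_le P F hk i) ?_
  have := fAt_add_ycount P F i
  have := length_block_le P F i
  omega

/-- `|depVar x| ≤ m · k · cap + m + 1`. [folklore] -/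
theorem length_depVar_le {k : ℕ} (hk : ∀ c ∈ F, c.length ≤ k) (x : ℕ) :
    (depVar P F x).length ≤ bsz P * (k * P.cap) + bsz P + 1 := by
  unfold depVar
  split_ifs
  · exact (length_depBlock_le P F hk _).trans (Nat.le_succ _)
  · simp

/-- The width of the new formula: `k' = k · (m k cap + m + 1)`, `m = max l 1`.
[cite: ImpagliazzoPaturiJCSS2001, p. 372 ("k' = c l k²")] -/
def kOut (k cap len : ℕ) : ℕ := k * (max len 1 * (k * cap) + max len 1 + 1)

/-- `|depClause c| ≤ k'`. [folklore] -/
theorem length_depClause_le {k : ℕ} (hk : ∀ c ∈ F, c.length ≤ k) {c : List (ℕ × Bool)}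
    (hc : c ∈ F) : (depClause P F c).length ≤ kOut k P.cap P.len := by
  unfold depClause kOut
  rw [List.length_flatMap]
  have h : ∀ m ∈ c.map (fun l => (depVar P F l.1).length), m ≤ bsz P * (k * P.cap) + bsz P + 1 := by
    intro m hm
    obtain ⟨l, -, rfl⟩ := List.mem_map.1 hm
    exact length_depVar_le P F hk l.1
  calc (c.map fun l => (depVar P F l.1).length).sum
      ≤ (c.map fun l => (depVar P F l.1).length).length * (bsz P * (k * P.cap) + bsz P + 1) := by
        simpa using List.sum_le_card_nsmul _ _ h
    _ ≤ k * (bsz P * (k * P.cap) + bsz P + 1) := by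
        rw [List.length_map]; exact Nat.mul_le_mul_right _ (hk c hc)
    _ = k * (max P.len 1 * (k * P.cap) + max P.len 1 + 1) := rfl

/-- `|depTheta i| ≤ k'`. [folklore] -/
theorem length_depTheta_le_kOut {k : ℕ} (hk : ∀ c ∈ F, c.length ≤ k) (i : ℕ) :
    (depTheta P F i).length ≤ kOut k P.cap P.len := by
  refine (length_depTheta_le P F hk i).trans ?_
  unfold kOut bsz
  rcases Nat.eq_zero_or_pos k with rfl | hk0
  · simp
  · calc max P.len 1 * (k * P.cap) ≤ 1 * (max P.len 1 * (k * P.cap) + max P.len 1 + 1) := by omega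
      _ ≤ k * (max P.len 1 * (k * P.cap) + max P.len 1 + 1) := Nat.mul_le_mul_right _ hk0

/-! ### Ranges of the new indices -/

/-- Every index in `depForced x` is the new index of an `A`-variable. [folklore] -/
theorem mem_aList_of_mem_depForced {x v : ℕ} (hv : v ∈ depForced P F x) :
    ∃ z ∈ aList P F, newIdxA P F z = v := by
  obtain ⟨c, hc, -, l, hl, -, hB, rfl⟩ := (mem_depForced P F).1 hv
  exact ⟨l.1, (mem_aList P F).2 ⟨mem_occVars.2 ⟨c, hc, occursIn_eq_true.2 ⟨l, hl, rfl⟩⟩, hB⟩, rfl⟩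

/-- Every index in `depTheta i` is below `yOff p`. [folklore] -/
theorem lt_of_mem_depTheta {i v : ℕ} (hv : v ∈ depTheta P F i) : v < yOff P F (numBlocks P F) := by
  obtain ⟨z, -, hv⟩ := List.mem_flatMap.1 hv
  obtain ⟨y, hy, rfl⟩ := mem_aList_of_mem_depForced P F hv
  exact (newIdxA_lt P F hy).trans_le (yOff_mono P F (Nat.zero_le _))

/-- Every index in `depBlock i` (`i` in range) is below `yOff p`. [folklore] -/
theorem lt_of_mem_depBlock {i v : ℕ} (hi : i < numBlocks P F) (hv : v ∈ depBlock P F i) :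
    v < yOff P F (numBlocks P F) := by
  rcases List.mem_append.1 hv with hv | hv
  · exact lt_of_mem_depTheta P F hv
  · obtain ⟨r, hr, rfl⟩ := List.mem_map.1 hv
    exact newIdxY_lt P F hi (List.mem_range.1 hr)

/-- Every index in `depClause c` (`c ∈ F`) is below `yOff p`. [folklore] -/
theorem lt_of_mem_depClause {c : List (ℕ × Bool)} (hc : c ∈ F) {v : ℕ} (hv : v ∈ depClause P F c) :
    v < yOff P F (numBlocks P F) := by
  obtain ⟨l, hl, hv⟩ := List.mem_flatMap.1 hv
  unfold depVar at hv
  by_cases hB : inB P F l.1 = true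
  · rw [if_pos hB] at hv
    exact lt_of_mem_depBlock P F (blockOf_lt P F ((mem_bList P F).2 hB)) hv
  · rw [if_neg hB] at hv
    simp only [List.mem_singleton] at hv
    subst hv
    have hA : l.1 ∈ aList P F := (mem_aList P F).2
      ⟨mem_occVars.2 ⟨c, hc, occursIn_eq_true.2 ⟨l, hl, rfl⟩⟩, by simpa using hB⟩
    exact (newIdxA_lt P F hA).trans_le (yOff_mono P F (Nat.zero_le _))

end Forcing

/-! ### The reduced formula -/

section Reduce

variable (P : Params)

/-- The clauses of `Φ_{P}(F)`: the truth-table CNFs of the substituted clauses of `F` and of the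
slice constraints `Θ_i`. [cite: ImpagliazzoPaturiJCSS2001, p. 372 (Φ_f = F' ∧ ⋀ Θ_i)] -/
def outClauses (F : List (List (ℕ × Bool))) : List (List (ℕ × Bool)) :=
  (F.flatMap fun c => cnf (gClause P F c) (depClause P F c)) ++
  ((List.range (numBlocks P F)).flatMap fun i => cnf (theta P F i) (depTheta P F i))

/-- The occurring variables of a `KCNF` are below `numVars`. [folklore] -/
theorem card_occVars_le {k : ℕ} (φ : KCNF k) : (occVars φ.clauses).card ≤ φ.numVars := by
  calc (occVars φ.clauses).card ≤ (Finset.range φ.numVars).card := by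
        refine Finset.card_le_card fun x hx => ?_
        obtain ⟨c, hc, hx⟩ := mem_occVars.1 hx
        obtain ⟨l, hl, rfl⟩ := occursIn_eq_true.1 hx
        exact Finset.mem_range.2 (φ.fst_lt_numVars c hc l hl)
    _ = φ.numVars := Finset.card_range _

/-- **The reduction** `F ↦ Φ_P(F)`: a `k'`-CNF on `n - Σ_i f_i` variables, `k' = kOut k cap l`.
[cite: ImpagliazzoPaturiJCSS2001, Lemma 2 (p. 373) and pp. 371–372 (the construction)] -/
def reduce {k : ℕ} (φ : KCNF k) : KCNF (kOut k P.cap P.len) where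
  numVars := φ.numVars - fSum P φ.clauses
  clauses := outClauses P φ.clauses
  fst_lt_numVars := by
    intro c hc l hl
    have hbound : yOff P φ.clauses (numBlocks P φ.clauses) ≤ φ.numVars - fSum P φ.clauses := by
      have h1 := yOff_numBlocks_add_fSum P φ.clauses
      have h2 := card_occVars_le φ
      omega
    refine lt_of_lt_of_le ?_ hbound
    rcases List.mem_append.1 hc with hc | hc
    · obtain ⟨c₀, hc₀, hc⟩ := List.mem_flatMap.1 hc
      obtain ⟨bs, -, -, rfl⟩ := mem_cnf.1 hc
      exact lt_of_mem_depClause P φ.clauses hc₀ (fst_mem_of_mem_clauseOf hl)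
    · obtain ⟨i, -, hc⟩ := List.mem_flatMap.1 hc
      obtain ⟨bs, -, -, rfl⟩ := mem_cnf.1 hc
      exact lt_of_mem_depTheta P φ.clauses (fst_mem_of_mem_clauseOf hl)
  length_le := by
    intro c hc
    rcases List.mem_append.1 hc with hc | hc
    · obtain ⟨c₀, hc₀, hc⟩ := List.mem_flatMap.1 hc
      obtain ⟨bs, -, -, rfl⟩ := mem_cnf.1 hc
      exact (length_clauseOf_le _ _).trans (length_depClause_le P φ.clauses φ.length_le hc₀)
    · obtain ⟨i, -, hc⟩ := List.mem_flatMap.1 hc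
      obtain ⟨bs, -, -, rfl⟩ := mem_cnf.1 hc
      exact (length_clauseOf_le _ _).trans (length_depTheta_le_kOut P φ.clauses φ.length_le i)

/-- The number of variables of the reduced formula. [folklore] -/
theorem numVars_reduce {k : ℕ} (φ : KCNF k) :
    (reduce P φ).numVars = φ.numVars - fSum P φ.clauses := rfl

/-- The number of clauses of the reduced formula: at most `2^{k'} (|F| + |B|)`. [folklore] -/
theorem length_clauses_reduce_le {k : ℕ} (φ : KCNF k) :
    (reduce P φ).clauses.length ≤
      2 ^ kOut k P.cap P.len * (φ.clauses.length + numBlocks P φ.clauses) := by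
  show (outClauses P φ.clauses).length ≤ _
  unfold outClauses
  rw [List.length_append, List.length_flatMap, List.length_flatMap, Nat.mul_add]
  refine Nat.add_le_add ?_ ?_
  · have h : ∀ m ∈ φ.clauses.map (fun c => (cnf (gClause P φ.clauses c) (depClause P φ.clauses c)).length),
        m ≤ 2 ^ kOut k P.cap P.len := by
      intro m hm
      obtain ⟨c, hc, rfl⟩ := List.mem_map.1 hm
      exact (length_cnf_le _ _).trans
        (Nat.pow_le_pow_right (by norm_num) (length_depClause_le P φ.clauses φ.length_le hc))
    simpa [Nat.mul_comm] using List.sum_le_card_nsmul _ _ h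
  · have h : ∀ m ∈ (List.range (numBlocks P φ.clauses)).map
        (fun i => (cnf (theta P φ.clauses i) (depTheta P φ.clauses i)).length),
        m ≤ 2 ^ kOut k P.cap P.len := by
      intro m hm
      obtain ⟨i, -, rfl⟩ := List.mem_map.1 hm
      exact (length_cnf_le _ _).trans
        (Nat.pow_le_pow_right (by norm_num) (length_depTheta_le_kOut P φ.clauses φ.length_le i))
    simpa [Nat.mul_comm] using List.sum_le_card_nsmul _ _ h

end Reduce


/-! ### Soundness: a satisfying assignment of `Φ_P(F)` decodes to one of `F` -/

section Soundness

variable (P : Params)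

/-- `evalCNF` of an appended list. [folklore] -/
theorem evalCNF_append_eq_true {F G : List (List (ℕ × Bool))} {v : ℕ → Bool} :
    evalCNF (F ++ G) v = true ↔ evalCNF F v = true ∧ evalCNF G v = true := by
  simp only [evalCNF_eq_true, List.mem_append]
  exact ⟨fun h => ⟨fun c hc => h c (Or.inl hc), fun c hc => h c (Or.inr hc)⟩,
    fun h c hc => hc.elim (h.1 c) (h.2 c)⟩

/-- `evalCNF` of a `flatMap`. [folklore] -/
theorem evalCNF_flatMap_eq_true {ι : Type*} {L : List ι} {f : ι → List (List (ℕ × Bool))}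
    {v : ℕ → Bool} : evalCNF (L.flatMap f) v = true ↔ ∀ i ∈ L, evalCNF (f i) v = true := by
  simp only [evalCNF_eq_true, List.mem_flatMap]
  exact ⟨fun h i hi c hc => h c ⟨i, hi, hc⟩, fun h c ⟨i, hi, hc⟩ => h i hi c hc⟩

/-- Under a satisfying assignment of `Φ_P(F)`, every substituted clause of `F` holds.
[folklore] -/
theorem gClause_of_eval_outClauses {F : List (List (ℕ × Bool))} {w : ℕ → Bool}
    (h : evalCNF (outClauses P F) w = true) {c : List (ℕ × Bool)} (hc : c ∈ F) :
    gClause P F c w = true := by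
  rw [outClauses, evalCNF_append_eq_true, evalCNF_flatMap_eq_true] at h
  rw [← evalCNF_cnf (gClause_dependsOn P F c) w]
  exact h.1 c hc

/-- Under a satisfying assignment of `Φ_P(F)`, every slice constraint holds. [folklore] -/
theorem theta_of_eval_outClauses {F : List (List (ℕ × Bool))} {w : ℕ → Bool}
    (h : evalCNF (outClauses P F) w = true) {i : ℕ} (hi : i < numBlocks P F) :
    theta P F i w = true := by
  rw [outClauses, evalCNF_append_eq_true] at h
  rw [← evalCNF_cnf (theta_dependsOn P F i) w]
  exact evalCNF_flatMap_eq_true.1 h.2 i (List.mem_range.2 hi)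

/-- **Soundness of the reduction**: decoding (`x ↦ Ψ_x(w)` on `B`, the renamed copy on `A`) a
satisfying assignment `w` of `Φ_P(F)` satisfies `F`; this holds for *every* parameter `P`.
[cite: ImpagliazzoPaturiJCSS2001, Lemma 2 (p. 373), "the satisfiability of F is equivalent to …" (⇐)] -/
theorem evalCNF_decode {F : List (List (ℕ × Bool))} {w : ℕ → Bool}
    (h : evalCNF (outClauses P F) w = true) : evalCNF F (fun x => valVar P F x w) = true := by
  rw [evalCNF_eq_true]
  intro c hc
  have := gClause_of_eval_outClauses P h hc
  unfold gClause at this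
  exact this

/-- **Soundness of the reduction** for `KCNF`: if `Φ_P(φ)` is satisfiable then so is `φ`.
[cite: ImpagliazzoPaturiJCSS2001, Lemma 2 (p. 373) (⇐)] -/
theorem satisfiable_of_satisfiable_reduce {k : ℕ} (φ : KCNF k) (h : (reduce P φ).Satisfiable) :
    φ.Satisfiable := by
  obtain ⟨w, hw⟩ := (satisfiable_iff_exists _).1 h
  have hw' : evalCNF (outClauses P φ.clauses) w = true := hw
  refine (satisfiable_iff_exists φ).2 ⟨fun x => valVar P φ.clauses x w, ?_⟩
  rw [eval_eq_evalCNF]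
  exact evalCNF_decode P hw'

end Soundness

/-! ### Completeness: a satisfying assignment of `F` encodes into one of `Φ_P(F)` for the true
forcing profile -/

section Completeness

variable (P : Params) (F : List (List (ℕ × Bool))) (α : ℕ → Bool)

/-- `countP p + countP (¬ p) = length`. [folklore] -/
theorem countP_add_countP_not {α' : Type*} (l : List α') (p : α' → Bool) :
    l.countP p + l.countP (fun a => !p a) = l.length := by
  induction l with
  | nil => rfl
  | cons a t ih =>
    simp only [List.countP_cons, List.length_cons]
    cases p a <;> simp <;> omega

/-- The true forcing profile of `α`: the number of variables of each block forced by `α`.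
[folklore] -/
def profile : List ℕ :=
  (List.range (numBlocks P F)).map fun i => (block P F i).countP fun z => forced P F z α

/-- The parameters with the true forcing profile of `α` as `f`-vector. [folklore] -/
def withProfile : Params := { P with fv := profile P F α }

/-- Changing the `f`-vector does not change the partition. [folklore] -/
theorem inB_withProfile : inB (withProfile P F α) F = inB P F := rfl

/-- Changing the `f`-vector does not change `B`. [folklore] -/
theorem bList_withProfile : bList (withProfile P F α) F = bList P F := rfl

/-- Changing the `f`-vector does not change `A`. [folklore] -/
theorem aList_withProfile : aList (withProfile P F α) F = aList P F := rfl

/-- Changing the `f`-vector does not change the blocks. [folklore] -/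
theorem block_withProfile (i : ℕ) : block (withProfile P F α) F i = block P F i := rfl

/-- Changing the `f`-vector does not change the number of blocks. [folklore] -/
theorem numBlocks_withProfile : numBlocks (withProfile P F α) F = numBlocks P F := rfl

/-- Changing the `f`-vector does not change forcing. [folklore] -/
theorem forced_withProfile : forced (withProfile P F α) F = forced P F := rfl

/-- Changing the `f`-vector does not change `blockOf`. [folklore] -/
theorem blockOf_withProfile : blockOf (withProfile P F α) F = blockOf P F := rfl

/-- Changing the `f`-vector does not change `posIn`. [folklore] -/
theorem posIn_withProfile : posIn (withProfile P F α) F = posIn P F := rfl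

/-- With the true profile, `f_i` is the number of forced variables of block `i`. [folklore] -/
theorem fAt_withProfile (i : ℕ) :
    fAt (withProfile P F α) F i = (block P F i).countP fun z => forced P F z α := by
  unfold fAt
  rw [block_withProfile]
  by_cases hi : i < numBlocks P F
  · have : (withProfile P F α).fv.getD i 0 = (block P F i).countP fun z => forced P F z α := by
      show (profile P F α).getD i 0 = _
      rw [List.getD_eq_getElem _ _ (by simpa [profile] using hi)]
      simp [profile]
    rw [this]
    exact min_eq_left (List.countP_le_length)
  · rw [block_eq_nil_of_le P F (not_lt.1 hi)]
    simp

/-- With the true profile, `|Y_i|` is the number of unforced variables of block `i`. [folklore] -/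
theorem ycount_withProfile (i : ℕ) :
    ycount (withProfile P F α) F i = (block P F i).countP fun z => !forced P F z α := by
  unfold ycount
  rw [fAt_withProfile, block_withProfile, ← countP_add_countP_not (block P F i) fun z => forced P F z α]
  omega

/-- With the true profile, `Σ f_i` is the number of forced variables of `B`. [folklore] -/
theorem fSum_withProfile :
    fSum (withProfile P F α) F = (bList P F).countP fun z => forced P F z α := by
  unfold fSum
  rw [numBlocks_withProfile]
  conv_rhs => rw [← flatten_blocks P F, List.countP_flatten, List.map_map]
  congr 1
  exact List.map_congr_left fun i _ => fAt_withProfile P F α i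

/-- The unforced variables of block `i`, in order. [folklore] -/
def unforcedList (i : ℕ) : List ℕ := (block P F i).filter fun z => !forced P F z α

/-- The block of a `Y`-index `v`: the last `i ≤ p` with `yOff i ≤ v`. [folklore] -/
def yBlockOf (Q : Params) (v : ℕ) : ℕ := Nat.findGreatest (fun i => yOff Q F i ≤ v) (numBlocks Q F)

/-- **The encoding** of an assignment `α` of `F` as an assignment of the new variables: the
`A`-variables keep their values, `y_{i,r}` takes the value of the `r`-th unforced variable of
block `i`. [cite: ImpagliazzoPaturiJCSS2001, p. 372] -/
def encode (v : ℕ) : Bool :=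
  if h : v < (aList P F).length then α ((aList P F)[v])
  else
    let i := yBlockOf F (withProfile P F α) v
    α ((unforcedList P F α i).getD (v - yOff (withProfile P F α) F i) 0)

/-- The encoding restores the `A`-variables. [folklore] -/
theorem encode_newIdxA {x : ℕ} (hx : x ∈ aList P F) :
    encode P F α (newIdxA (withProfile P F α) F x) = α x := by
  have h := newIdxA_lt (withProfile P F α) F (by rwa [aList_withProfile])
  rw [aList_withProfile] at h
  unfold encode
  rw [dif_pos h]
  simp [newIdxA, aList_withProfile, List.getElem_idxOf (List.idxOf_lt_length_of_mem hx)]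

/-- Hence the `A`-part of the encoding is `α` where forcing reads it. [folklore] -/
theorem aOf_encode_agree (x : ℕ) :
    ∀ c ∈ F, occursIn x c = true → ∀ l ∈ c, l.1 ≠ x → inB (withProfile P F α) F l.1 = false →
      aOf (withProfile P F α) F (encode P F α) l.1 = α l.1 := by
  intro c hc _ l hl _ hB
  unfold aOf
  refine encode_newIdxA P F α ((mem_aList P F).2 ⟨?_, hB⟩)
  exact mem_occVars.2 ⟨c, hc, occursIn_eq_true.2 ⟨l, hl, rfl⟩⟩

/-- Forcing under the encoding is forcing under `α`. [folklore] -/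
theorem forcedTo_encode (x : ℕ) (p : Bool) :
    forcedTo (withProfile P F α) F x p (aOf (withProfile P F α) F (encode P F α)) =
      forcedTo P F x p α :=
  forcedTo_congr _ F x p (aOf_encode_agree P F α x)

/-- Forcing under the encoding is forcing under `α`. [folklore] -/
theorem forced_encode (x : ℕ) :
    forced (withProfile P F α) F x (aOf (withProfile P F α) F (encode P F α)) = forced P F x α :=
  forced_congr _ F x (aOf_encode_agree P F α x)

/-- The block of a valid `Y`-index. [folklore] -/
theorem yBlockOf_newIdxY (Q : Params) {i r : ℕ} (hi : i < numBlocks Q F) (hr : r < ycount Q F i) :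
    yBlockOf F Q (newIdxY Q F i r) = i := by
  unfold yBlockOf
  rw [Nat.findGreatest_eq_iff]
  refine ⟨hi.le, fun _ => Nat.le_add_right _ _, fun j hij _ hle => ?_⟩
  have := yOff_mono Q F (Nat.succ_le_of_lt hij)
  rw [yOff_succ] at this
  unfold newIdxY at hle
  omega

/-- The encoding at a `Y`-index: the value of the corresponding unforced variable. [folklore] -/
theorem encode_newIdxY {i r : ℕ} (hi : i < numBlocks P F)
    (hr : r < ycount (withProfile P F α) F i) :
    encode P F α (newIdxY (withProfile P F α) F i r) = α ((unforcedList P F α i).getD r 0) := by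
  have hge : (aList P F).length ≤ newIdxY (withProfile P F α) F i r := by
    have := yOff_mono (withProfile P F α) F (Nat.zero_le i)
    unfold newIdxY; exact this.trans (Nat.le_add_right _ _)
  unfold encode
  rw [dif_neg (not_lt.2 hge)]
  simp only [yBlockOf_newIdxY F (withProfile P F α) (by rwa [numBlocks_withProfile]) hr]
  simp [newIdxY]

/-- In a list, the member at position `j` satisfying `p` sits in `filter p` at the position
counting the earlier members satisfying `p`. [folklore] -/
theorem getElem_filter_countP {α' : Type*} (p : α' → Bool) :
    ∀ (L : List α') (j : ℕ) (hj : j < L.length), p L[j] = true →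
      ∃ h : (L.take j).countP p < (L.filter p).length, (L.filter p)[(L.take j).countP p] = L[j]
  | [], j, hj, _ => by simp at hj
  | a :: t, 0, _, hp => by
    have ha : p a = true := by simpa using hp
    exact ⟨by simp [List.filter_cons_of_pos ha], by simp [List.filter_cons_of_pos ha]⟩
  | a :: t, j + 1, hj, hp => by
    obtain ⟨h, e⟩ := getElem_filter_countP p t j (by simpa using hj) (by simpa using hp)
    by_cases ha : p a = true
    · refine ⟨by simp [List.filter_cons_of_pos ha, ha]; exact h, ?_⟩
      simp [List.filter_cons_of_pos ha, ha, e]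
    · refine ⟨by simp [List.filter_cons_of_neg ha, ha]; exact h, ?_⟩
      simp [List.filter_cons_of_neg ha, ha, e]

/-- **The decoded values of the encoding are the values of `α`** on occurring variables,
provided `α` satisfies `F` (forced variables then have the forced value).
[cite: ImpagliazzoPaturiJCSS2001, p. 372 ("observe that the following proposition is satisfiable")] -/
theorem valVar_encode (hα : evalCNF F α = true) {x : ℕ} (hx : x ∈ occVars F) :
    valVar (withProfile P F α) F x (encode P F α) = α x := by
  unfold valVar
  by_cases hB : inB (withProfile P F α) F x = true
  · rw [if_pos hB]
    have hxB : x ∈ bList P F := (mem_bList _ F).2 hB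
    -- forced values are the values of `α`
    have key : ∀ p : Bool, forcedTo P F x p α = true → α x = p := by
      intro p hp
      obtain ⟨c, hc, hoth⟩ := List.any_eq_true.1 hp
      obtain ⟨hcF, -, hl⟩ := (mem_forcingClauses P F).1 hc
      obtain ⟨l, hlc, hαl⟩ := evalClause_eq_true.1 (evalCNF_eq_true.1 hα c hcF)
      rcases hl l hlc with ⟨h1, h2⟩ | ⟨h1, -⟩
      · rw [← h1, hαl, h2]
      · exfalso
        have := List.all_eq_true.1 hoth l hlc
        simp [h1, hαl] at this
    unfold psi
    rw [forcedTo_encode, forced_encode]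
    cases hT : forcedTo P F x true α
    · cases hF : forcedTo P F x false α
      · -- unforced: renamed
        have hunf : forced P F x α = false := by simp [forced, hT, hF]
        simp only [forced, hT, hF, Bool.or_self, Bool.not_false, Bool.true_and, Bool.false_or]
        unfold yval
        have hr : unforcedBefore (withProfile P F α) F x (aOf (withProfile P F α) F (encode P F α)) =
            ((block P F (blockOf P F x)).take (posIn P F x)).countP fun z => !forced P F z α := by
          unfold unforcedBefore
          exact countP_congr_mem _ fun z _ => by rw [forced_encode]
        rw [hr]
        simp only [blockOf_withProfile]
        set i := blockOf P F x
        obtain ⟨hpos, hget⟩ := getElem_block_blockOf P F hxB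
        obtain ⟨hlt, e⟩ := getElem_filter_countP (fun z => !forced P F z α) (block P F i)
          (posIn P F x) hpos (by rw [hget]; simpa using hunf)
        have hyc : ycount (withProfile P F α) F i = (unforcedList P F α i).length := by
          rw [ycount_withProfile, unforcedList, List.countP_eq_length_filter]
        have hlt' : ((block P F i).take (posIn P F x)).countP (fun z => !forced P F z α) <
            ycount (withProfile P F α) F i := by rw [hyc]; exact hlt
        rw [if_pos hlt', encode_newIdxY P F α (blockOf_lt P F hxB) hlt']
        change α ((unforcedList P F α i).getD _ 0) = α x
        unfold unforcedList
        rw [List.getD_eq_getElem _ _ hlt, e, hget]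
      · -- forced to false
        simp [forced, hT, hF, key false hF]
    · simp [key true hT]
  · rw [if_neg hB]
    rw [inB_withProfile] at hB
    exact encode_newIdxA P F α ((mem_aList P F).2 ⟨hx, by simpa using hB⟩)

/-- **Completeness of the reduction**: an assignment satisfying `F` encodes into an assignment
satisfying `Φ_P(F)` for the parameters carrying its true forcing profile.
[cite: ImpagliazzoPaturiJCSS2001, Lemma 2 (p. 373) (⇒)] -/
theorem evalCNF_outClauses_encode (hα : evalCNF F α = true) :
    evalCNF (outClauses (withProfile P F α) F) (encode P F α) = true := by
  rw [outClauses, evalCNF_append_eq_true, evalCNF_flatMap_eq_true, evalCNF_flatMap_eq_true]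
  refine ⟨fun c hc => ?_, fun i _ => ?_⟩
  · rw [evalCNF_cnf (gClause_dependsOn _ F c)]
    unfold gClause
    rw [← evalCNF_eq_true.1 hα c hc, evalClause]
    refine any_congr_mem _ fun l hl => ?_
    rw [valVar_encode P F α hα (mem_occVars.2 ⟨c, hc, occursIn_eq_true.2 ⟨l, hl, rfl⟩⟩)]
  · rw [evalCNF_cnf (theta_dependsOn _ F i)]
    unfold theta
    rw [fAt_withProfile, block_withProfile, beq_iff_eq]
    exact countP_congr_mem _ fun z _ => by rw [forced_encode]

/-- **Completeness** for `KCNF`: if `φ` is satisfied by `α` then `Φ_P(φ)` with the true profile of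
`α` is satisfiable, and it has `n - #{forced variables of B}` variables.
[cite: ImpagliazzoPaturiJCSS2001, Lemma 2 (p. 373) (⇒)] -/
theorem satisfiable_reduce_withProfile {k : ℕ} (φ : KCNF k) (hα : φ.eval α = true) :
    (reduce (withProfile P φ.clauses α) φ).Satisfiable ∧
      (reduce (withProfile P φ.clauses α) φ).numVars =
        φ.numVars - (bList P φ.clauses).countP fun z => forced P φ.clauses z α := by
  refine ⟨(satisfiable_iff_exists _).2 ⟨encode P φ.clauses α, ?_⟩, ?_⟩
  · exact evalCNF_outClauses_encode P φ.clauses α hα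
  · rw [numVars_reduce, fSum_withProfile]

end Completeness


/-! ### Minimal satisfying assignments and critical clauses -/

section Critical

variable (F : List (List (ℕ × Bool)))

/-- `α` is a *minimal* satisfying assignment of `F`: flipping any true variable to false
falsifies `F` (so `α` is isolated with respect to each of its ones).
[cite: ImpagliazzoPaturiJCSS2001, p. 374 ("Let α be a minimal assignment")] -/
def IsMinimalSat (α : ℕ → Bool) : Prop :=
  evalCNF F α = true ∧ ∀ x, α x = true → evalCNF F (Function.update α x false) = false

/-- A *critical clause* for `x` at `α` (`α x = true`): a clause of `F` containing the literal `x`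
positively and not negatively, all whose other literals are false under `α`.
[cite: ImpagliazzoPaturiJCSS2001, §1.1 (critical clauses), p. 369] -/
def IsCritClause (α : ℕ → Bool) (x : ℕ) (c : List (ℕ × Bool)) : Prop :=
  c ∈ F ∧ (x, true) ∈ c ∧ (∀ l ∈ c, l.1 = x → l.2 = true) ∧ ∀ l ∈ c, l.1 ≠ x → α l.1 ≠ l.2

/-- **Ones of a minimal assignment are critical**: each has a critical clause.
[cite: ImpagliazzoPaturiJCSS2001, §1.1 ("if x is isolated … there must exist a critical clause"),
p. 374 ("by minimality α is isolated with respect to each of these variables")] -/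
theorem exists_critClause {α : ℕ → Bool} (h : IsMinimalSat F α) {x : ℕ} (hx : α x = true) :
    ∃ c, IsCritClause F α x c := by
  obtain ⟨hsat, hmin⟩ := h
  have hfl : ¬ evalCNF F (Function.update α x false) = true := by
    rw [hmin x hx]; exact Bool.false_ne_true
  rw [evalCNF_eq_true] at hfl
  push Not at hfl
  obtain ⟨c, hc, hcf⟩ := hfl
  -- every literal of `c` is false after the flip
  have hval : ∀ l ∈ c, Function.update α x false l.1 ≠ l.2 := fun l hl e =>
    hcf (evalClause_eq_true.2 ⟨l, hl, e⟩)
  obtain ⟨l₀, hl₀, hαl₀⟩ := evalClause_eq_true.1 (evalCNF_eq_true.1 hsat c hc)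
  have hl₀x : l₀.1 = x := by
    by_contra hne
    exact hval l₀ hl₀ (by rw [Function.update_of_ne hne]; exact hαl₀)
  have hl₀p : l₀.2 = true := by rw [← hαl₀, hl₀x, hx]
  refine ⟨c, hc, ?_, fun l hl hlx => ?_, fun l hl hlx => ?_⟩
  · have : l₀ = (x, true) := Prod.ext hl₀x hl₀p
    rwa [this] at hl₀
  · have := hval l hl
    rw [hlx, Function.update_self] at this
    cases h2 : l.2
    · exact absurd h2.symm (by simpa using this)
    · rfl
  · have := hval l hl
    rwa [Function.update_of_ne hlx] at this

/-- Ones of a minimal assignment occur in `F`. [folklore] -/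
theorem mem_occVars_of_minimal {α : ℕ → Bool} (h : IsMinimalSat F α) {x : ℕ} (hx : α x = true) :
    x ∈ occVars F := by
  obtain ⟨c, hc, hxc, -⟩ := exists_critClause F h hx
  exact mem_occVars.2 ⟨c, hc, occursIn_eq_true.2 ⟨(x, true), hxc, rfl⟩⟩

/-- The *light ones* of `α`: occurring light variables (`occ ≤ cap`) set to true.
[cite: ImpagliazzoPaturiJCSS2001, p. 374 (the δn isolated ones), with heavy variables removed] -/
def critLight (cap : ℕ) (α : ℕ → Bool) : Finset ℕ :=
  (occVars F).filter fun x => occ F x ≤ cap ∧ α x = true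

/-- The ones of `α` below `n`. [folklore] -/
def onesBelow (n : ℕ) (α : ℕ → Bool) : Finset ℕ := (Finset.range n).filter fun x => α x = true

/-- **Light ones are many**: `#ones ≤ #light ones + #heavy variables` for a minimal assignment
(all of whose ones occur). [folklore] -/
theorem card_onesBelow_le {α : ℕ → Bool} (h : IsMinimalSat F α) (n cap : ℕ) :
    (onesBelow n α).card ≤ (critLight F cap α).card + (heavyVars F cap).card := by
  rw [← Finset.card_union_of_disjoint]
  · refine Finset.card_le_card fun x hx => ?_
    have hαx : α x = true := (Finset.mem_filter.1 hx).2
    have hocc := mem_occVars_of_minimal F h hαx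
    by_cases hl : occ F x ≤ cap
    · exact Finset.mem_union_left _ (Finset.mem_filter.2 ⟨hocc, hl, hαx⟩)
    · exact Finset.mem_union_right _ (Finset.mem_filter.2 ⟨hocc, not_le.1 hl⟩)
  · rw [Finset.disjoint_left]
    intro x h1 h2
    exact not_lt.2 (Finset.mem_filter.1 h1).2.1 (Finset.mem_filter.1 h2).2

/-- **A minimal satisfying assignment exists** (supported below `numVars`) as soon as `φ` is
satisfiable: take a satisfying assignment with the fewest ones.
[cite: ImpagliazzoPaturiJCSS2001, p. 374] -/
theorem exists_minimalSat {k : ℕ} (φ : KCNF k) (h : φ.Satisfiable) :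
    ∃ α : ℕ → Bool, IsMinimalSat φ.clauses α ∧ ∀ x, α x = true → x < φ.numVars := by
  classical
  -- satisfying assignments supported below `n`, measured by their number of ones
  let S : Set ℕ := {m | ∃ α : ℕ → Bool, evalCNF φ.clauses α = true ∧
    (∀ x, α x = true → x < φ.numVars) ∧ (onesBelow φ.numVars α).card = m}
  obtain ⟨v, hv⟩ := h
  have hne : ∃ m, m ∈ S := by
    refine ⟨_, fun i => if h : i < φ.numVars then v ⟨i, h⟩ else false, ?_, fun x hx => ?_, rfl⟩
    · rw [← eval_eq_evalCNF]; exact hv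
    · by_contra hn
      simp only [dif_neg hn] at hx
      exact Bool.false_ne_true hx
  obtain ⟨α, hα, hsupp, hcard⟩ := Nat.find_spec hne
  refine ⟨α, ⟨hα, fun x hx => ?_⟩, hsupp⟩
  by_contra hsat
  rw [Bool.not_eq_false] at hsat
  have hlt : (onesBelow φ.numVars (Function.update α x false)).card <
      (onesBelow φ.numVars α).card := by
    refine Finset.card_lt_card ⟨fun y hy => ?_, ?_⟩
    · simp only [onesBelow, Finset.mem_filter] at hy ⊢
      refine ⟨hy.1, ?_⟩
      by_cases hyx : y = x
      · subst hyx; simp at hy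
      · rw [Function.update_of_ne hyx] at hy; exact hy.2
    · intro hsub
      have := hsub (Finset.mem_filter.2 ⟨Finset.mem_range.2 (hsupp x hx), hx⟩)
      simp [onesBelow] at this
  have hmem : (onesBelow φ.numVars (Function.update α x false)).card ∈ S :=
    ⟨_, hsat, fun y hy => by
      by_cases hyx : y = x
      · subst hyx; simp at hy
      · rw [Function.update_of_ne hyx] at hy; exact hsupp y hy, rfl⟩
  have := Nat.find_min' hne hmem
  rw [hcard] at hlt
  exact absurd this (not_le.2 hlt)

end Critical

/-! ### The averaging argument: a good set of colours exists -/

section Averaging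

open Finset

/-- Extension of a colour-valued function on `Fin b` to all of `ℕ` (value `1`, "not selected",
outside). [folklore] -/
def gext {b k : ℕ} (g : Fin b → Fin k) (c : ℕ) : ℕ := if hc : c < b then (g ⟨c, hc⟩).1 else 1

/-- `x` is *good* for `g`: its colour is selected (`g = 0`) and the colours in `N x` are not.
[cite: ImpagliazzoPaturiJCSS2001, proof of Lemma 1 ("x ∈ B and all other variables in C_x are in A")] -/
def Good {b k : ℕ} (h : ℕ → ℕ) (N : ℕ → Finset ℕ) (g : Fin b → Fin k) (x : ℕ) : Prop :=
  gext g (h x) = 0 ∧ ∀ c ∈ N x, gext g c ≠ 0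

/-- `Good` is decidable (a conjunction of decidable statements). [folklore] -/
instance {b k : ℕ} (h : ℕ → ℕ) (N : ℕ → Finset ℕ) (g : Fin b → Fin k) :
    DecidablePred (Good h N g) := fun _ => inferInstanceAs (Decidable (_ ∧ _))

/-- The box of functions prescribed at `c₀` (value `0`) and on `S` (nonzero values).
[folklore] -/
def box {b k : ℕ} (hk : 1 ≤ k) (c₀ : Fin b) (S : Finset (Fin b)) : Fin b → Finset (Fin k) :=
  fun c => if c = c₀ then {⟨0, hk⟩} else if c ∈ S then univ.erase ⟨0, hk⟩ else univ

/-- **Counting the box**: `(k-1)^{|S|} · k^{b-1-|S|}` functions (`c₀ ∉ S`). [folklore] -/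
theorem card_piFinset_box {b k : ℕ} (hk : 1 ≤ k) (c₀ : Fin b) (S : Finset (Fin b))
    (hc₀ : c₀ ∉ S) :
    (Fintype.piFinset (box hk c₀ S)).card = (k - 1) ^ S.card * k ^ (b - 1 - S.card) := by
  classical
  rw [Fintype.card_piFinset]
  have h1 : ∀ c, (box hk c₀ S c).card = if c = c₀ then 1 else if c ∈ S then k - 1 else k := by
    intro c
    unfold box
    split_ifs <;> simp [Finset.card_erase_of_mem]
  simp_rw [h1]
  rw [← Finset.mul_prod_erase univ _ (mem_univ c₀), if_pos rfl, one_mul]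
  rw [Finset.prod_congr rfl (g := fun c => if c ∈ S then k - 1 else k) fun c hc => by
    rw [if_neg (ne_of_mem_erase hc)]]
  rw [Finset.prod_ite, Finset.prod_const, Finset.prod_const]
  congr 2
  · rw [Finset.filter_mem_eq_inter, Finset.inter_eq_right.2]
    intro c hc
    exact mem_erase.2 ⟨fun h => by subst h; exact hc₀ hc, mem_univ c⟩
  · have := Finset.card_filter_add_card_filter_not (s := univ.erase c₀) (fun c => c ∈ S)
    rw [Finset.filter_mem_eq_inter, Finset.inter_eq_right.2 (fun c hc =>
      mem_erase.2 ⟨fun h => by subst h; exact hc₀ hc, mem_univ c⟩),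
      Finset.card_erase_of_mem (mem_univ c₀), Finset.card_univ, Fintype.card_fin] at this
    omega

/-- Monotonicity of the box count in `|S| ≤ k - 1`. [folklore] -/
theorem box_count_mono {b k d : ℕ} (hk : 1 ≤ k) (hd : d ≤ k - 1) (hkb : k ≤ b) :
    (k - 1) ^ (k - 1) * k ^ (b - k) ≤ (k - 1) ^ d * k ^ (b - 1 - d) := by
  have e1 : (k - 1) ^ (k - 1) = (k - 1) ^ d * (k - 1) ^ (k - 1 - d) := by
    rw [← pow_add]; congr 1; omega
  have e2 : k ^ (b - 1 - d) = k ^ (k - 1 - d) * k ^ (b - k) := by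
    rw [← pow_add]; congr 1; omega
  rw [e1, e2, Nat.mul_assoc]
  refine Nat.mul_le_mul_left _ (Nat.mul_le_mul_right _ ?_)
  exact Nat.pow_le_pow_left (Nat.sub_le k 1) _

/-- **Averaging lemma**: if every `x ∈ U` has a colour `h x < b` and a set `N x` of at most
`k - 1` further colours below `b`, then for some `g : Fin b → Fin k` at least a
`(k-1)^{k-1} / k^k ≥ 1/(ek)` fraction of `U` is good. (The source takes a random partition with
`Pr[x ∈ B] = 1/k`, `k`-wise independent; here the colour classes play the role of the
independent events.) [cite: ImpagliazzoPaturiJCSS2001, Lemma 1 (p. 371) and the paragraph after it] -/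
theorem exists_good {b k : ℕ} (hk : 1 ≤ k) (hkb : k ≤ b) (U : Finset ℕ) (h : ℕ → ℕ)
    (N : ℕ → Finset ℕ) (hh : ∀ x ∈ U, h x < b) (hN : ∀ x ∈ U, ∀ c ∈ N x, c < b)
    (hhN : ∀ x ∈ U, h x ∉ N x) (hcard : ∀ x ∈ U, (N x).card ≤ k - 1) :
    ∃ g : Fin b → Fin k,
      (k - 1) ^ (k - 1) * U.card ≤ k ^ k * (U.filter fun x => Good h N g x).card := by
  classical
  -- the weight of `g`: the number of good elements
  set W : (Fin b → Fin k) → ℕ := fun g => (U.filter fun x => Good h N g x).card with hW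
  -- lower bound on the total weight, by double counting
  have hsum : (k - 1) ^ (k - 1) * k ^ (b - k) * U.card ≤ ∑ g, W g := by
    have hdc : ∑ g, W g = ∑ x ∈ U, (univ.filter fun g : Fin b → Fin k => Good h N g x).card := by
      simp only [hW, Finset.card_filter]
      exact Finset.sum_comm
    rw [hdc, Nat.mul_comm, ← smul_eq_mul, ← Finset.sum_const]
    refine Finset.sum_le_sum fun x hx => ?_
    -- the box of `x` consists of good functions
    set c₀ : Fin b := ⟨h x, hh x hx⟩
    set S : Finset (Fin b) := univ.filter fun c => c.1 ∈ N x
    have hc₀S : c₀ ∉ S := fun hc => hhN x hx (by simpa [S, c₀] using hc)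
    have hS : S.card = (N x).card := by
      refine Finset.card_bij (fun c _ => c.1) (fun c hc => by simpa [S] using hc)
        (fun c₁ _ c₂ _ e => Fin.ext e) (fun c hc => ?_)
      exact ⟨⟨c, hN x hx c hc⟩, by simpa [S] using hc, rfl⟩
    have hsub : Fintype.piFinset (box hk c₀ S) ⊆ univ.filter fun g : Fin b → Fin k => Good h N g x := by
      intro g hg
      rw [Fintype.mem_piFinset] at hg
      refine mem_filter.2 ⟨mem_univ _, ?_, fun c hc => ?_⟩
      · have := hg c₀
        simp only [box, if_true, mem_singleton] at this
        simp only [gext, dif_pos (hh x hx)]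
        rw [show (⟨h x, hh x hx⟩ : Fin b) = c₀ from rfl, this]
      · have hcb := hN x hx c hc
        have hcS : (⟨c, hcb⟩ : Fin b) ∈ S := by simpa [S] using hc
        have hne : (⟨c, hcb⟩ : Fin b) ≠ c₀ := fun e => hc₀S (e ▸ hcS)
        have := hg ⟨c, hcb⟩
        simp only [box, if_neg hne, if_pos hcS, mem_erase] at this
        simp only [gext, dif_pos hcb, ne_eq]
        intro h0
        exact this.1 (Fin.ext h0)
    calc (k - 1) ^ (k - 1) * k ^ (b - k) ≤ (k - 1) ^ S.card * k ^ (b - 1 - S.card) :=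
          box_count_mono hk (hS ▸ hcard x hx) hkb
      _ = (Fintype.piFinset (box hk c₀ S)).card := (card_piFinset_box hk c₀ S hc₀S).symm
      _ ≤ _ := Finset.card_le_card hsub
  -- a function of maximal weight
  haveI : Nonempty (Fin b → Fin k) := ⟨fun _ => ⟨0, hk⟩⟩
  obtain ⟨g, -, hg⟩ := Finset.exists_max_image univ W univ_nonempty
  refine ⟨g, ?_⟩
  have hmax : ∑ g', W g' ≤ k ^ b * W g := by
    have := Finset.sum_le_card_nsmul univ W (W g) fun g' _ => hg g' (mem_univ _)
    simpa [Fintype.card_fin, Fintype.card_fun] using this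
  have hkpos : 0 < k ^ (b - k) := Nat.pow_pos hk
  refine Nat.le_of_mul_le_mul_left ?_ hkpos
  calc k ^ (b - k) * ((k - 1) ^ (k - 1) * U.card) = (k - 1) ^ (k - 1) * k ^ (b - k) * U.card := by
        ring
    _ ≤ ∑ g', W g' := hsum
    _ ≤ k ^ b * W g := hmax
    _ = k ^ (b - k) * (k ^ k * W g) := by
        rw [← Nat.mul_assoc, ← pow_add]; congr 2; omega

end Averaging


/-! ### A good mask forces many variables -/

section GoodMask

variable (F : List (List (ℕ × Bool)))

/-- The number of colours used: `b = k · cap + k + 1 > col x` for light `x`, and `b ≥ k`.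
[folklore] -/
def numCols (k cap : ℕ) : ℕ := k * cap + k + 1

/-- The mask (set of selected colours) described by a Boolean tuple. [folklore] -/
def maskOf (bs : List Bool) : ℕ → Bool := fun c => bs.getD c false

/-- The Boolean tuple of a colour-valued function: colour `c` is selected iff `g c = 0`.
[folklore] -/
def bsOf {b k : ℕ} (g : Fin b → Fin k) : List Bool := (List.finRange b).map fun c => decide ((g c).1 = 0)

/-- `bsOf g` has length `b`. [folklore] -/
theorem length_bsOf {b k : ℕ} (g : Fin b → Fin k) : (bsOf g).length = b := by simp [bsOf]

/-- The mask of `bsOf g` selects exactly the colours with `gext g = 0`. [folklore] -/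
theorem maskOf_bsOf {b k : ℕ} (g : Fin b → Fin k) (c : ℕ) :
    maskOf (bsOf g) c = decide (gext g c = 0) := by
  unfold maskOf bsOf gext
  by_cases hc : c < b
  · rw [List.getD_eq_getElem _ _ (by simpa using hc), dif_pos hc]
    simp
  · rw [List.getD_eq_default _ _ (by simpa using not_lt.1 hc), dif_neg hc]
    simp

open Classical in
/-- A chosen critical clause for `x` at `α` (empty if there is none). [folklore] -/
noncomputable def critClauseOf (α : ℕ → Bool) (x : ℕ) : List (ℕ × Bool) :=
  if h : ∃ c, IsCritClause F α x c then Classical.choose h else []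

/-- The chosen clause is critical when a critical clause exists. [folklore] -/
theorem isCritClause_critClauseOf {α : ℕ → Bool} {x : ℕ} (h : ∃ c, IsCritClause F α x c) :
    IsCritClause F α x (critClauseOf F α x) := by
  classical
  unfold critClauseOf; rw [dif_pos h]; exact Classical.choose_spec h

/-- The colours of the other light variables of the chosen critical clause of `x`. [folklore] -/
noncomputable def nbrCols (cap : ℕ) (α : ℕ → Bool) (x : ℕ) : Finset ℕ :=
  (((critClauseOf F α x).filter fun l => l.1 ≠ x ∧ occ F l.1 ≤ cap).map
    fun l => col F cap l.1).toFinset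

/-- **A good mask exists**: for a minimal satisfying assignment `α`, some mask puts at least a
`(k-1)^{k-1}/k^k` fraction of the light ones of `α` among the *forced* variables of `B`
(whatever the block length and `f`-vector).
[cite: ImpagliazzoPaturiJCSS2001, Lemma 1 (p. 371) and the sketch of proof of Lemma 2 (p. 374)] -/
theorem exists_goodMask {k : ℕ} (hk : ∀ c ∈ F, c.length ≤ k) (hk1 : 1 ≤ k) (cap : ℕ)
    {α : ℕ → Bool} (hmin : IsMinimalSat F α) (len : ℕ) (fv : List ℕ) :
    ∃ g : Fin (numCols k cap) → Fin k,
      (k - 1) ^ (k - 1) * (critLight F cap α).card ≤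
        k ^ k * ((bList ⟨cap, len, maskOf (bsOf g), fv⟩ F).countP fun z =>
          forced ⟨cap, len, maskOf (bsOf g), fv⟩ F z α) := by
  classical
  set U := critLight F cap α
  have hU : ∀ x ∈ U, x ∈ occVars F ∧ occ F x ≤ cap ∧ α x = true := fun x hx => by
    simpa [U, critLight] using hx
  have hcrit : ∀ x ∈ U, IsCritClause F α x (critClauseOf F α x) := fun x hx =>
    isCritClause_critClauseOf F (exists_critClause F hmin (hU x hx).2.2)
  have hb : ∀ z, occ F z ≤ cap → col F cap z < numCols k cap := fun z hz =>
    (col_le F hk cap hz).trans_lt (by unfold numCols; omega)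
  obtain ⟨g, hg⟩ := exists_good hk1 (by unfold numCols; omega) U (col F cap) (nbrCols F cap α)
    (fun x hx => hb x (hU x hx).2.1)
    (fun x hx c hc => by
      simp only [nbrCols, List.mem_toFinset, List.mem_map, List.mem_filter, decide_eq_true_eq] at hc
      obtain ⟨l, ⟨-, -, hl⟩, rfl⟩ := hc
      exact hb _ hl)
    (fun x hx hc => by
      simp only [nbrCols, List.mem_toFinset, List.mem_map, List.mem_filter, decide_eq_true_eq] at hc
      obtain ⟨l, ⟨hl, hlx, hll⟩, he⟩ := hc
      obtain ⟨hcF, hxc, -, -⟩ := hcrit x hx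
      refine col_ne_col F cap (Ne.symm hlx) (hU x hx).2.1 hll ?_ he.symm
      exact cooccur_eq_true.2 ⟨_, hcF, occursIn_eq_true.2 ⟨_, hxc, rfl⟩,
        occursIn_eq_true.2 ⟨l, hl, rfl⟩⟩)
    (fun x hx => by
      obtain ⟨hcF, hxc, -, -⟩ := hcrit x hx
      refine (List.toFinset_card_le _).trans ?_
      rw [List.length_map]
      have h1 := List.length_eq_length_filter_add (l := critClauseOf F α x)
        fun l => decide (l.1 ≠ x ∧ occ F l.1 ≤ cap)
      have h2 : 0 < ((critClauseOf F α x).filter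
          fun l => !decide (l.1 ≠ x ∧ occ F l.1 ≤ cap)).length :=
        List.length_pos_of_mem (List.mem_filter.2 ⟨hxc, by simp⟩)
      have h3 := hk _ hcF
      omega)
  refine ⟨g, hg.trans (Nat.mul_le_mul_left _ ?_)⟩
  set P : Params := ⟨cap, len, maskOf (bsOf g), fv⟩
  -- good variables are forced members of `B`
  have hgood : ∀ x ∈ U.filter (fun x => Good (col F cap) (nbrCols F cap α) g x),
      x ∈ bList P F ∧ forced P F x α = true := by
    intro x hx
    obtain ⟨hxU, hG1, hG2⟩ := Finset.mem_filter.1 hx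
    obtain ⟨hocc, hlight, hαx⟩ := hU x hxU
    have hBx : inB P F x = true := by
      simp only [inB, hocc, hlight, decide_true, Bool.true_and, P, maskOf_bsOf, hG1]
    refine ⟨(mem_bList P F).2 hBx, ?_⟩
    obtain ⟨hcF, hxc, hpol, hoth⟩ := hcrit x hxU
    have hforc : critClauseOf F α x ∈ forcingClauses P F x true := by
      refine (mem_forcingClauses P F).2 ⟨hcF, occursIn_eq_true.2 ⟨_, hxc, rfl⟩, fun l hl => ?_⟩
      by_cases hlx : l.1 = x
      · exact Or.inl ⟨hlx, hpol l hl hlx⟩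
      · refine Or.inr ⟨hlx, ?_⟩
        by_cases hll : occ F l.1 ≤ cap
        · have hcN : col F cap l.1 ∈ nbrCols F cap α x := by
            simp only [nbrCols, List.mem_toFinset, List.mem_map, List.mem_filter, decide_eq_true_eq]
            exact ⟨l, ⟨hl, hlx, hll⟩, rfl⟩
          have := hG2 _ hcN
          simp [inB, P, maskOf_bsOf, this]
        · simp [inB, P, hll]
    unfold forced forcedTo
    rw [Bool.or_eq_true]
    left
    refine List.any_eq_true.2 ⟨_, hforc, ?_⟩
    unfold othersFalse
    refine List.all_eq_true.2 fun l hl => ?_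
    by_cases hlx : l.1 = x
    · simp [hlx]
    · have := hoth l hl hlx
      simp [hlx, this]
  calc (U.filter fun x => Good (col F cap) (nbrCols F cap α) g x).card
      ≤ ((bList P F).filter fun z => forced P F z α).toFinset.card := by
        refine Finset.card_le_card fun x hx => ?_
        obtain ⟨h1, h2⟩ := hgood x hx
        exact List.mem_toFinset.2 (List.mem_filter.2 ⟨h1, h2⟩)
    _ = ((bList P F).filter fun z => forced P F z α).length :=
        List.toFinset_card_of_nodup ((nodup_bList P F).filter _)
    _ = (bList P F).countP fun z => forced P F z α := (List.countP_eq_length_filter).symm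

end GoodMask

/-! ### The list of disjuncts and its properties -/

section ReduceList

/-- All `f`-vectors dominated by the size vector `ss` (`f_i ≤ s_i`). [folklore] -/
def fvecs : List ℕ → List (List ℕ)
  | [] => [[]]
  | s :: ss => (List.range (s + 1)).flatMap fun f => (fvecs ss).map (f :: ·)

/-- Membership in `fvecs`: pointwise domination. [folklore] -/
theorem mem_fvecs {ss fv : List ℕ} : fv ∈ fvecs ss ↔ List.Forall₂ (· ≤ ·) fv ss := by
  induction ss generalizing fv with
  | nil => cases fv <;> simp [fvecs]
  | cons s ss ih =>
    cases fv with
    | nil => simp [fvecs]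
    | cons f fv =>
      simp only [fvecs, List.mem_flatMap, List.mem_range, List.mem_map, List.cons.injEq,
        List.forall₂_cons, Nat.lt_succ_iff]
      constructor
      · rintro ⟨f', hf', fv', hfv', rfl, rfl⟩; exact ⟨hf', ih.1 hfv'⟩
      · rintro ⟨hf, hfv⟩; exact ⟨f, hf, fv, ih.2 hfv, rfl, rfl⟩

/-- The number of `f`-vectors is `∏ (s_i + 1)`. [folklore] -/
theorem length_fvecs (ss : List ℕ) : (fvecs ss).length = (ss.map (· + 1)).prod := by
  induction ss with
  | nil => rfl
  | cons s ss ih =>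
    simp only [fvecs, List.length_flatMap, List.length_map, ih, List.map_cons, List.prod_cons]
    simp [List.sum_replicate, List.map_const']

/-- The block sizes of the partition (they do not depend on the `f`-vector). [folklore] -/
def sizes (P : Params) (F : List (List (ℕ × Bool))) : List ℕ :=
  (List.range (numBlocks P F)).map fun i => (block P F i).length

/-- The block sizes do not depend on the `f`-vector. [folklore] -/
theorem sizes_eq_sizes (cap len : ℕ) (mask : ℕ → Bool) (fv fv' : List ℕ)
    (F : List (List (ℕ × Bool))) : sizes ⟨cap, len, mask, fv⟩ F = sizes ⟨cap, len, mask, fv'⟩ F :=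
  rfl

/-- For a dominated `f`-vector, `Σ_i f_i` (truncated) is the plain sum. [folklore] -/
theorem fSum_eq_sum (cap len : ℕ) (mask : ℕ → Bool) (fv : List ℕ) (F : List (List (ℕ × Bool)))
    (h₀ : List.Forall₂ (· ≤ ·) fv (sizes ⟨cap, len, mask, []⟩ F)) :
    fSum ⟨cap, len, mask, fv⟩ F = fv.sum := by
  set P : Params := ⟨cap, len, mask, fv⟩
  have h : List.Forall₂ (· ≤ ·) fv (sizes P F) := by
    rwa [sizes_eq_sizes cap len mask [] fv] at h₀
  have hlen : fv.length = numBlocks P F := by simpa [sizes] using h.length_eq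
  unfold fSum
  congr 1
  refine List.ext_getElem (by simp [hlen]) fun i h1 h2 => ?_
  simp only [List.getElem_map, List.getElem_range]
  unfold fAt
  have hi : i < numBlocks P F := by simpa using h1
  have hle := List.forall₂_iff_get.1 h
  obtain ⟨-, hle⟩ := hle
  have := hle i h2 (by simpa [sizes] using hi)
  simp only [List.get_eq_getElem, sizes, List.getElem_map, List.getElem_range] at this
  rw [List.getD_eq_getElem _ _ h2]
  exact min_eq_left this

/-- **The list of disjuncts** `Φ_{mask, f}(φ)` over all masks on the `b = numCols k cap` colours and
all dominated `f`-vectors with `Σ f_i ≥ t`. [cite: ImpagliazzoPaturiJCSS2001, Lemma 2 (p. 373)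
and p. 372 ("Φ = ⋁_f Φ_f where f ranges over all vectors … such that Σ f_i ≥ …")] -/
noncomputable def reduceList (k cap len t : ℕ) (φ : KCNF k) : List (KCNF (kOut k cap len)) :=
  (tuples (numCols k cap)).flatMap fun bs =>
    ((fvecs (sizes ⟨cap, len, maskOf bs, []⟩ φ.clauses)).filter fun fv => decide (t ≤ fv.sum)).map
      fun fv => (reduce ⟨cap, len, maskOf bs, fv⟩ φ : KCNF (kOut k cap len))

/-- Membership in `reduceList`. [folklore] -/
theorem mem_reduceList {k cap len t : ℕ} {φ : KCNF k} {Φ : KCNF (kOut k cap len)} :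
    Φ ∈ reduceList k cap len t φ ↔ ∃ bs, bs.length = numCols k cap ∧ ∃ fv,
      List.Forall₂ (· ≤ ·) fv (sizes ⟨cap, len, maskOf bs, []⟩ φ.clauses) ∧ t ≤ fv.sum ∧
      Φ = reduce ⟨cap, len, maskOf bs, fv⟩ φ := by
  simp only [reduceList, List.mem_flatMap, mem_tuples, List.mem_map, List.mem_filter, mem_fvecs,
    decide_eq_true_eq]
  constructor
  · rintro ⟨bs, hbs, fv, ⟨h1, h2⟩, h3⟩; exact ⟨bs, hbs, fv, h1, h2, h3.symm⟩
  · rintro ⟨bs, hbs, fv, h1, h2, h3⟩; exact ⟨bs, hbs, fv, ⟨h1, h2⟩, h3.symm⟩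

/-- **Soundness of every disjunct.** [cite: ImpagliazzoPaturiJCSS2001, Lemma 2 (p. 373) (⇐)] -/
theorem satisfiable_of_mem_reduceList {k cap len t : ℕ} {φ : KCNF k} {Φ : KCNF (kOut k cap len)}
    (hΦ : Φ ∈ reduceList k cap len t φ) (h : Φ.Satisfiable) : φ.Satisfiable := by
  obtain ⟨bs, -, fv, -, -, rfl⟩ := mem_reduceList.1 hΦ
  exact satisfiable_of_satisfiable_reduce _ φ h

/-- **Every disjunct has at most `n - t` variables.**
[cite: ImpagliazzoPaturiJCSS2001, Lemma 2 (p. 373) ("on at most n(1 - δ/(ek)) variables")] -/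
theorem numVars_le_of_mem_reduceList {k cap len t : ℕ} {φ : KCNF k} {Φ : KCNF (kOut k cap len)}
    (hΦ : Φ ∈ reduceList k cap len t φ) : Φ.numVars ≤ φ.numVars - t := by
  obtain ⟨bs, -, fv, hfv, ht, rfl⟩ := mem_reduceList.1 hΦ
  rw [numVars_reduce, fSum_eq_sum cap len _ fv _ hfv]
  omega

/-- A product of factors `s_i + 1 ≤ m + 1`, trivial off `p`, is at most `(m+1)^{#p}`. [folklore] -/
theorem prod_map_succ_le {m : ℕ} (s : ℕ → ℕ) (p : ℕ → Prop) [DecidablePred p] :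
    ∀ L : List ℕ, (∀ i ∈ L, s i ≤ m) → (∀ i ∈ L, ¬ p i → s i = 0) →
      (L.map fun i => s i + 1).prod ≤ (m + 1) ^ (L.countP fun i => decide (p i))
  | [], _, _ => by simp
  | i :: L, h1, h2 => by
    have ih := prod_map_succ_le s p L (fun j hj => h1 j (by simp [hj])) (fun j hj => h2 j (by simp [hj]))
    simp only [List.map_cons, List.prod_cons, List.countP_cons]
    by_cases hp : p i
    · simp only [hp, decide_true, ite_true, pow_succ]
      calc (s i + 1) * (L.map fun i => s i + 1).prod ≤ (m + 1) * (m + 1) ^ (L.countP fun i => decide (p i)) :=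
            Nat.mul_le_mul (Nat.succ_le_succ (h1 i (by simp))) ih
        _ = _ := by ring
    · simp only [hp, decide_false, h2 i (by simp) hp]
      simpa using ih

/-- **The number of disjuncts**: at most `2^b · (m+1)^{n/m + 1}`, `m = max l 1`,
`b = numCols k cap`. (Choosing `l` with `log₂(l+1)/l ≤ ε` makes this `≤ 2^b (l+1) 2^{ε n}`.)
[cite: ImpagliazzoPaturiJCSS2001, p. 372 ("the number of vectors f is at most (l+1)^{n/l}")] -/
theorem length_reduceList_le (k cap len t : ℕ) (φ : KCNF k) :
    (reduceList k cap len t φ).length ≤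
      2 ^ numCols k cap * (max len 1 + 1) ^ (φ.numVars / max len 1 + 1) := by
  classical
  unfold reduceList
  rw [List.length_flatMap]
  refine (List.sum_le_card_nsmul _ ((max len 1 + 1) ^ (φ.numVars / max len 1 + 1)) ?_).trans
    (le_of_eq (by rw [List.length_map, length_tuples, smul_eq_mul]))
  · intro x hx
    obtain ⟨bs, -, rfl⟩ := List.mem_map.1 hx
    set P : Params := ⟨cap, len, maskOf bs, []⟩
    rw [List.length_map]
    refine (List.length_filter_le _ _).trans ?_
    rw [length_fvecs]
    have hm : 0 < bsz P := bsz_pos P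
    -- nonempty blocks have index `< |B|/m + 1`
    have key := prod_map_succ_le (m := bsz P) (fun i => (block P φ.clauses i).length)
      (fun i => i * bsz P < (bList P φ.clauses).length) (List.range (numBlocks P φ.clauses))
      (fun i _ => length_block_le P _ i)
      (fun i _ hi => by rw [block_eq_nil P _ (not_lt.1 hi)]; rfl)
    simp only [sizes, List.map_map]
    refine (le_of_eq (by rfl)).trans (key.trans ?_)
    refine Nat.pow_le_pow_right (by omega) ?_
    rw [List.countP_eq_length_filter]
    have hsub : ((List.range (numBlocks P φ.clauses)).filter fun i =>
        decide (i * bsz P < (bList P φ.clauses).length)).toFinset ⊆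
        Finset.range ((bList P φ.clauses).length / bsz P + 1) := by
      intro i hi
      simp only [List.mem_toFinset, List.mem_filter, List.mem_range, decide_eq_true_eq] at hi
      exact Finset.mem_range.2 (Nat.lt_succ_of_le ((Nat.le_div_iff_mul_le hm).2 hi.2.le))
    calc ((List.range (numBlocks P φ.clauses)).filter fun i =>
          decide (i * bsz P < (bList P φ.clauses).length)).length
        = (((List.range (numBlocks P φ.clauses)).filter fun i =>
          decide (i * bsz P < (bList P φ.clauses).length)).toFinset).card :=
          (List.toFinset_card_of_nodup ((List.nodup_range).filter _)).symm
      _ ≤ (Finset.range ((bList P φ.clauses).length / bsz P + 1)).card := Finset.card_le_card hsub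
      _ = (bList P φ.clauses).length / bsz P + 1 := Finset.card_range _
      _ ≤ φ.numVars / max len 1 + 1 := by
          refine Nat.succ_le_succ (Nat.div_le_div_right ?_)
          calc (bList P φ.clauses).length ≤ (occVars φ.clauses).card := by
                rw [← length_aList_add_length_bList P]; exact Nat.le_add_left _ _
            _ ≤ φ.numVars := card_occVars_le φ

/-- The `f`-vector of the true profile is dominated by the block sizes. [folklore] -/
theorem forall₂_profile_sizes (P : Params) (F : List (List (ℕ × Bool))) (α : ℕ → Bool) :
    List.Forall₂ (· ≤ ·) (profile P F α) (sizes P F) := by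
  unfold profile sizes
  rw [List.forall₂_map_left_iff, List.forall₂_map_right_iff]
  exact List.forall₂_same.2 fun i _ => List.countP_le_length

/-- **Completeness of the list**: if `φ` has a minimal satisfying assignment `α` whose light ones
are numerous enough, `(k-1)^{k-1} · #critLight ≥ k^k · t`, then some disjunct is satisfiable.
[cite: ImpagliazzoPaturiJCSS2001, Lemma 2 (p. 373) (⇒) with Lemma 1] -/
theorem exists_satisfiable_mem_reduceList {k : ℕ} (hk1 : 1 ≤ k) (cap len t : ℕ) (φ : KCNF k)
    {α : ℕ → Bool} (hmin : IsMinimalSat φ.clauses α)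
    (ht : k ^ k * t ≤ (k - 1) ^ (k - 1) * (critLight φ.clauses cap α).card) :
    ∃ Φ ∈ reduceList k cap len t φ, Φ.Satisfiable := by
  obtain ⟨g, hg⟩ := exists_goodMask φ.clauses φ.length_le hk1 cap hmin len []
  set P : Params := ⟨cap, len, maskOf (bsOf g), []⟩
  have hprof := satisfiable_reduce_withProfile P α φ hmin.1
  refine ⟨reduce (withProfile P φ.clauses α) φ, mem_reduceList.2 ⟨bsOf g, length_bsOf g,
    profile P φ.clauses α, forall₂_profile_sizes P φ.clauses α, ?_, rfl⟩, hprof.1⟩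
  -- the threshold
  have hsum : (profile P φ.clauses α).sum =
      (bList P φ.clauses).countP fun z => forced P φ.clauses z α := by
    rw [← fSum_eq_sum cap len (maskOf (bsOf g)) (profile P φ.clauses α) φ.clauses
      (forall₂_profile_sizes P φ.clauses α)]
    exact fSum_withProfile P φ.clauses α
  rw [hsum]
  have hkk : 0 < k ^ k := Nat.pow_pos hk1
  exact Nat.le_of_mul_le_mul_left (ht.trans hg) hkk

end ReduceList

end IPRename

end Literature.Computability.FineGrained
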